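import Literature.Probability.Percolation.ArcPivotalBoundary
import Literature.Probability.Percolation.ArcFourArmExplicit
import Literature.Probability.Percolation.LandedAltPivotalSum
import HarnessLib

/-!
# The pivotal sum of the arc-landed four-arm event (proofs only)

Topic `Literature/Probability/Percolation`; family `crit-perc`. PROOFS ONLY (no definition, no
named fact). Serves the named fact `Literature.Probability.Percolation.Werner2009_lemma63`
(Werner 2009, Lecture 6, Lemma 6.3 for the tree's ORDER-FREE `π̂_t`) through Nolin's Thm. 27,
Case 3, for the arc-landed host `E = arcFourArm a b r₀ N`, `(a, b) ∈ {(0, 3), (3, 0)}`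
(W. Werner, PCMI 2009, Lecture 6, §5: "`|d/dp π̂_p(n)| ≤ … ≤ c'' π̂_p(n) × [n² π̂_p(n)]`"; P. Nolin,
EJP 13 (2008), §6.2, proof of Thm. 27). Part 1: the per-site bounds
`P_t(v pivotal for E) ≤ K · weight(v) · π̂^alt_t(r₀, N) · P_t(E)` in the five regimes of the
summation (as `LandedAltPivotalSum.lean` for the landed ALTERNATING host), from DISPLAYED kernel
inputs: alternating quasi-multiplicativity `hQ` and lower bound `hL`, the local factor bound
`hLoc` (`L^alt_c(l) ≤ K_l π̂^alt_t(r, 2^l)`, supplied by `local_factor_alt_le`), the host gluing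
`hHost : c_H P_t(innerArc(r₀, m)) P_t(outerArc(m', N)) ≤ P_t(E)` and extension
`hExt : c_E P_t(innerArc(r₀, M)) ≤ P_t(E)`, and the half-plane pair bound
`hHP : P_t(B_{T,F}(m, n)) ≤ C_H m/n`:

* numerics: `min_le_rpow_mul_rpow`, `sum_two_rpow_Ico_le`, `bracket_deep_le`,
  `bracket_shallow_le` — the brackets of `boundary_pivotal_le_arc` / `boundary_pivotal_le_arc₂`
  are `O((d'/N)^{1-ε})` (the sum over the dyadic scale of the defect, made summable by
  `min(1, x) ≤ x^{1-ε}`);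
* `measureReal_isPivotal_arcFourArm_le₂` — inner host event and local event only;
* `arc_pivotal_small` (`|v| < K₀`: outer arms, host gluing with the explicit lower bound
  `arcFourArm_lowerBound` of the inner piece), `arc_pivotal_inner` (the bulk: three annuli),
  `arc_pivotal_mid` (two annuli), `arc_pivotal_deep` (boundary layer, three factors),
  `arc_pivotal_shallow` (boundary layer, two factors).

Part 2: summing the per-site bounds of Part 1
over the shells of `Λ_N` (as `landedPivotalSum_le`, `LandedAltPivotalSum.lean`, for the landed
alternating host),

* `measureReal_isPivotal_arcFourArm_eq_zero` — no pivotal sites off the annulus;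
* `cL_rpow_le_sq_mul_alt` — `c_L N^β ≤ N² π̂^alt_t(r₀, N)` from the a priori lower bound;
* `arcPivotalSum_le` — **the pivotal sum**: there are `K` and `N₀`, depending only on the
  displayed kernel constants and thresholds, such that for `1/2 ≤ t ≤ 3/4`, `N ≥ N₀` and the kernel
  inputs at `(t, N)` (alternating quasi-multiplicativity `hQ` and lower bound `hL`, local factor
  bound `hLoc`, host gluing `hHost` and extension `hExt`, half-plane pair bound `hHP`),
  `Σ_{v} P_t(v pivotal for E) ≤ K · N² π̂^alt_t(r₀, N) · P_t(E)`.

## References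

* W. Werner, *Lectures on two-dimensional critical percolation*, IAS/Park City Math. Ser. 16
  (2009), Lecture 6, §5 (proof of Lemma 6.3) and proof of Lemma 6.2 [WernerPCMI2009].
* P. Nolin, Near-critical percolation in two dimensions, *Electron. J. Probab.* 13 (2008), §4.6,
  Prop. 18, §6.2 proof of Thm. 27 [arXiv 0711.4948: Thm. 26] [Nolin2008].
* H. Kesten, Scaling relations for 2D-percolation, *Comm. Math. Phys.* 109 (1987) [KestenScalingCMP1987].

## Mathlib / tree

Tree: `boundary_pivotal_le_arc`, `boundary_pivotal_le_arc₂`, `measureReal_le_of_subset_localAlt_gen`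
(`ArcPivotalBoundary.lean`), `measureReal_isPivotal_arcFourArm_le`,
`isPivotal_arcFourArm_subset_inner/outer/localAlt` (`ArcLandedPivotalCut.lean`),
`arcFourArm_lowerBound` (`ArcFourArmExplicit.lean`), `innerArcFourArm_anti`,
`outerArcFourArm_mono_left`, `determinedBy_arcFourArm` (`ArcLandedFourArm.lean`),
`kernel_le_ratio_mul`, `cL_le_sq_mul_alt`, `sq_le_rpow_two_sub`, `layer_sum_deep_le`,
`layer_sum_shallow_le`, `sum_shell_weight_le`, `card_triSphere_le`, `sum_triBall_eq_sum_triSphere`,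
`div_rpow_two_sub`, `altFourArmProbAt_mono_left/anti/nonneg/le_one`; Mathlib `geom_sum_eq`,
`Real.rpow_*`.
-/

noncomputable section

open MeasureTheory Set Finset Real
open scoped unitInterval

namespace Literature.Probability.Percolation

open LatticeModels

/-! ## Part 1: the per-site bounds -/


/-! ### Numerics -/

section Numerics

/-- `min(a, b) ≤ a^ε b^{1-ε}` for `a, b ≥ 0`, `0 ≤ ε ≤ 1`. [folklore] -/
theorem min_le_rpow_mul_rpow {a b ε : ℝ} (ha : 0 ≤ a) (hb : 0 ≤ b) (hε0 : 0 ≤ ε) (hε1 : ε ≤ 1) :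
    min a b ≤ a ^ ε * b ^ (1 - ε) := by
  rcases eq_or_lt_of_le ha with rfl | ha'
  · rw [min_eq_left hb]
    exact mul_nonneg (Real.rpow_nonneg le_rfl _) (Real.rpow_nonneg hb _)
  rcases eq_or_lt_of_le hb with rfl | hb'
  · rw [min_eq_right ha]
    exact mul_nonneg (Real.rpow_nonneg ha _) (Real.rpow_nonneg le_rfl _)
  rcases le_total a b with hab | hab
  · rw [min_eq_left hab]
    calc a = a ^ ε * a ^ (1 - ε) := by rw [← Real.rpow_add ha']; simp
      _ ≤ a ^ ε * b ^ (1 - ε) :=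
          mul_le_mul_of_nonneg_left (Real.rpow_le_rpow ha hab (by linarith)) (Real.rpow_nonneg ha _)
  · rw [min_eq_right hab]
    calc b = b ^ ε * b ^ (1 - ε) := by rw [← Real.rpow_add hb']; simp
      _ ≤ a ^ ε * b ^ (1 - ε) :=
          mul_le_mul_of_nonneg_right (Real.rpow_le_rpow hb hab hε0) (Real.rpow_nonneg hb _)

/-- `(2^{k})^ε = (2^ε)^{k}`. [folklore] -/
theorem two_pow_rpow (k : ℕ) (ε : ℝ) : ((2 : ℝ) ^ k) ^ ε = ((2 : ℝ) ^ ε) ^ k := by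
  rw [← Real.rpow_natCast, ← Real.rpow_mul (by norm_num), mul_comm, Real.rpow_mul (by norm_num),
    Real.rpow_natCast]

/-- A geometric sum: `Σ_{a ≤ k' < K} (2^{k'})^ε ≤ (2^K)^ε / (2^ε - 1)` for `ε > 0`. [folklore] -/
theorem sum_two_rpow_Ico_le {ε : ℝ} (hε : 0 < ε) (a K : ℕ) :
    ∑ k' ∈ Finset.Ico a K, ((2 : ℝ) ^ k') ^ ε ≤ ((2 : ℝ) ^ K) ^ ε / ((2 : ℝ) ^ ε - 1) := by
  have hx1 : (1 : ℝ) < (2 : ℝ) ^ ε := Real.one_lt_rpow (by norm_num) hε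
  have hx0 : (0 : ℝ) < (2 : ℝ) ^ ε - 1 := by linarith
  calc ∑ k' ∈ Finset.Ico a K, ((2 : ℝ) ^ k') ^ ε
      ≤ ∑ k' ∈ Finset.range K, ((2 : ℝ) ^ k') ^ ε :=
        Finset.sum_le_sum_of_subset_of_nonneg (fun k' hk' => by
          rw [Finset.mem_Ico] at hk'; exact Finset.mem_range.2 hk'.2) fun _ _ _ => by positivity
    _ = ∑ k' ∈ Finset.range K, ((2 : ℝ) ^ ε) ^ k' := by simp_rw [two_pow_rpow]
    _ = (((2 : ℝ) ^ ε) ^ K - 1) / ((2 : ℝ) ^ ε - 1) := geom_sum_eq hx1.ne' K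
    _ ≤ ((2 : ℝ) ^ ε) ^ K / ((2 : ℝ) ^ ε - 1) := by
        apply div_le_div_of_nonneg_right _ hx0.le; linarith
    _ = ((2 : ℝ) ^ K) ^ ε / ((2 : ℝ) ^ ε - 1) := by rw [two_pow_rpow]

/-- `x^ε ≤ 1 + x` for `x ≥ 0`, `0 ≤ ε ≤ 1`. [folklore] -/
theorem rpow_le_one_add {x ε : ℝ} (hx : 0 ≤ x) (hε0 : 0 ≤ ε) (hε1 : ε ≤ 1) : x ^ ε ≤ 1 + x := by
  rcases le_total x 1 with h | h
  · exact (Real.rpow_le_one hx h hε0).trans (by linarith)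
  · calc x ^ ε ≤ x ^ (1 : ℝ) := Real.rpow_le_rpow_of_exponent_le h hε1
      _ = x := Real.rpow_one x
      _ ≤ 1 + x := by linarith

/-- `y ≤ y^{1-ε}` for `0 ≤ y ≤ 1`, `0 ≤ ε`. [folklore] -/
theorem le_rpow_one_sub {y ε : ℝ} (hy : 0 ≤ y) (hy1 : y ≤ 1) (hε0 : 0 ≤ ε) :
    y ≤ y ^ (1 - ε) := by
  rcases eq_or_lt_of_le hy with rfl | hy'
  · exact Real.rpow_nonneg le_rfl _
  · calc y = y ^ (1 : ℝ) := (Real.rpow_one y).symm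
      _ ≤ y ^ (1 - ε) := Real.rpow_le_rpow_of_exponent_ge hy' hy1 (by linarith)

/-- From `B ≤ C_H m/n` and `m Z ≤ c y n`: `B ≤ C_H (c y / Z)`. [folklore] -/
theorem le_of_hp {B CH m n y Z c : ℝ} (hCH : 0 ≤ CH) (hn : 0 < n) (hZ : 0 < Z)
    (hB : B ≤ CH * (m / n)) (hkey : m * Z ≤ c * y * n) : B ≤ CH * (c * y / Z) := by
  refine hB.trans (mul_le_mul_of_nonneg_left ?_ hCH)
  rw [div_le_div_iff₀ hn hZ]; linarith

/-- From `B ≤ C_H m/n` and `C_H m Z ≤ x n`: `B ≤ x / Z`. [folklore] -/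
theorem le_div_of_hp {B CH m n x Z : ℝ} (hn : 0 < n) (hZ : 0 < Z)
    (hB : B ≤ CH * (m / n)) (hkey : CH * m * Z ≤ x * n) : B ≤ x / Z := by
  refine hB.trans ?_
  rw [mul_div_assoc', div_le_div_iff₀ hn hZ]; exact hkey

/-- **The bracket of the deep boundary layer is `O((d'/N)^{1-ε})`.** With
`B(m, n) = P_t(domArmEvent ![T,F] m n upperHalfPlane) ≤ C_H m/n` (`n₀ ≤ m ≤ n ≤ N`), `D = 2^{K₂+2}`,
`16 · 2^{K₂} ≤ N < 2^{K₂+5}`, `2^{l+3} ≤ d' < 2^{l+4}`, `n₀ ≤ d' < 2^{K₂-3}`: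
the bracket of `boundary_pivotal_le_arc` is at most `K_B (d'/N)^{1-ε}`,
`K_B = 152 C_H + (1 + 192 C_H)(1 + 1152 C_H² + 1344 C_H)/(2^ε - 1)` (each term of the sum over the
scale `2^{k'}` of the defect is `≤ min(192 C_H 2^{k'}, (1152 C_H² + 1344 C_H) d')/N
≤ (192 C_H 2^{k'})^ε ((1152 C_H² + 1344 C_H) d')^{1-ε}/N`, a geometric sum). [cite: Nolin2008, §4.6, Prop. 18 (arms with defects: the sum over the scale of the defect)] [cite: WernerPCMI2009, Lecture 6, proof of Lemma 6.2 (boundary contributions)] -/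
theorem bracket_deep_le {t : unitInterval} {CH ε : ℝ} {n₀ N l d' K₂ D : ℕ} (hCH : 0 ≤ CH)
    (hε0 : 0 < ε) (hε1 : ε ≤ 1)
    (hHP : ∀ m n : ℕ, n₀ ≤ m → m ≤ n → n ≤ N →
      (triSitePercolation t).real (domArmEvent ![true, false] m n upperHalfPlane) ≤ CH * ((m : ℝ) / n))
    (hD : D = 2 ^ (K₂ + 2)) (hK₂N : 16 * 2 ^ K₂ ≤ N) (hNK₂ : N < 2 ^ (K₂ + 5))
    (hl : 2 ^ (l + 3) ≤ d') (hl' : d' < 2 ^ (l + 4)) (hdK : d' < 2 ^ (K₂ - 3)) (hn₀ : n₀ ≤ d')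
    (hK₂ : 4 ≤ K₂) :
    (triSitePercolation t).real
        (domArmEvent ![true, false] (2 ^ (l + 2) + d') (D - d') upperHalfPlane) +
      ∑ k' ∈ Finset.Ico (l + 1) K₂,
        (if 2 ^ (l + 2) + 2 * d' + 1 ≤ 2 ^ (k' - 1) then
          (triSitePercolation t).real
            (domArmEvent ![true, false] (2 ^ (l + 2) + d') (2 ^ (k' - 1) - d') upperHalfPlane)
          else 1) *
        (triSitePercolation t).real
          (domArmEvent ![true, false] (2 ^ (k' + 2) + d') (D - d') upperHalfPlane) +
      (triSitePercolation t).real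
        (domArmEvent ![true, false] (2 ^ (l + 2) + d') (2 ^ (K₂ - 1) - d') upperHalfPlane) ≤
      (152 * CH + (1 + 192 * CH) * (1 + 1152 * CH ^ 2 + 1344 * CH) / ((2 : ℝ) ^ ε - 1)) *
        ((d' : ℝ) / N) ^ (1 - ε) := by
  set B : ℕ → ℕ → ℝ := fun m n =>
    (triSitePercolation t).real (domArmEvent ![true, false] m n upperHalfPlane) with hB
  have hB0 : ∀ m n, 0 ≤ B m n := fun m n => measureReal_nonneg
  have hB1 : ∀ m n, B m n ≤ 1 := fun m n => measureReal_le_one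
  -- sizes, as multiples of `2^{K₂-3}` and `2^{l+2}`
  have hP3 : 1 ≤ 2 ^ (K₂ - 3) := Nat.one_le_two_pow
  have eK0 : 2 ^ K₂ = 2 ^ (K₂ - 3) * 8 := by
    rw [show (8 : ℕ) = 2 ^ 3 by norm_num, ← pow_add]; congr 1; omega
  have eK1 : 2 ^ (K₂ - 1) = 2 ^ (K₂ - 3) * 4 := by
    rw [show (4 : ℕ) = 2 ^ 2 by norm_num, ← pow_add]; congr 1; omega
  have eK1' : 2 ^ (K₂ + 1) = 2 ^ (K₂ - 3) * 16 := by
    rw [show (16 : ℕ) = 2 ^ 4 by norm_num, ← pow_add]; congr 1; omega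
  have eK2 : 2 ^ (K₂ + 2) = 2 ^ (K₂ - 3) * 32 := by
    rw [show (32 : ℕ) = 2 ^ 5 by norm_num, ← pow_add]; congr 1; omega
  have eK5 : 2 ^ (K₂ + 5) = 2 ^ (K₂ - 3) * 256 := by
    rw [show (256 : ℕ) = 2 ^ 8 by norm_num, ← pow_add]; congr 1; omega
  have el3 : 2 ^ (l + 3) = 2 ^ (l + 2) * 2 := by rw [pow_succ]
  have el4 : 2 ^ (l + 4) = 2 ^ (l + 2) * 4 := by
    rw [show l + 4 = (l + 2) + 2 from rfl, pow_add]; norm_num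
  have hd1 : 1 ≤ d' := le_trans Nat.one_le_two_pow hl
  have hN0 : (0 : ℝ) < N := by exact_mod_cast (show 0 < N by omega)
  have hd0 : (0 : ℝ) < d' := by exact_mod_cast (show 0 < d' by omega)
  have hDd : D - d' ≤ N := by omega
  have hDd2 : D ≤ 2 * (D - d') := by omega
  have hDN : N ≤ 8 * D := by omega
  have hx1 : (1 : ℝ) < (2 : ℝ) ^ ε := Real.one_lt_rpow (by norm_num) hε0
  have hx0 : (0 : ℝ) < (2 : ℝ) ^ ε - 1 := by linarith
  have hratio0 : 0 ≤ (d' : ℝ) / N := by positivity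
  have hratio1 : (d' : ℝ) / N ≤ 1 := by rw [div_le_one hN0]; exact_mod_cast (show d' ≤ N by omega)
  have hpow : (d' : ℝ) / N ≤ ((d' : ℝ) / N) ^ (1 - ε) := le_rpow_one_sub hratio0 hratio1 hε0.le
  have hm1 : ((2 ^ (l + 2) + d' : ℕ) : ℝ) * 2 ≤ 3 * d' := by
    exact_mod_cast (show (2 ^ (l + 2) + d') * 2 ≤ 3 * d' by omega)
  have hm0 : (0 : ℝ) ≤ ((2 ^ (l + 2) + d' : ℕ) : ℝ) := by positivity
  -- (0) the first term
  have hn₁ : (0 : ℝ) < ((D - d' : ℕ) : ℝ) := by exact_mod_cast (show 0 < D - d' by omega)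
  have hn₁' : (N : ℝ) ≤ 16 * ((D - d' : ℕ) : ℝ) := by exact_mod_cast (show N ≤ 16 * (D - d') by omega)
  have hT₀ : B (2 ^ (l + 2) + d') (D - d') ≤ CH * (24 * (d' : ℝ) / N) := by
    refine le_of_hp hCH hn₁ hN0 (hHP _ _ (by omega) (by omega) hDd) ?_
    calc ((2 ^ (l + 2) + d' : ℕ) : ℝ) * N ≤ ((2 ^ (l + 2) + d' : ℕ) : ℝ) * (16 * ((D - d' : ℕ) : ℝ)) :=
          mul_le_mul_of_nonneg_left hn₁' hm0
      _ = ((2 ^ (l + 2) + d' : ℕ) : ℝ) * 2 * (8 * ((D - d' : ℕ) : ℝ)) := by ring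
      _ ≤ 3 * d' * (8 * ((D - d' : ℕ) : ℝ)) := mul_le_mul_of_nonneg_right hm1 (by positivity)
      _ = 24 * d' * ((D - d' : ℕ) : ℝ) := by ring
  -- (2) the last term
  have hn₂ : (0 : ℝ) < ((2 ^ (K₂ - 1) - d' : ℕ) : ℝ) := by
    exact_mod_cast (show 0 < 2 ^ (K₂ - 1) - d' by omega)
  have hn₂' : (N : ℝ) * 3 ≤ 256 * ((2 ^ (K₂ - 1) - d' : ℕ) : ℝ) := by
    exact_mod_cast (show N * 3 ≤ 256 * (2 ^ (K₂ - 1) - d') by omega)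
  have hT₂ : B (2 ^ (l + 2) + d') (2 ^ (K₂ - 1) - d') ≤ CH * (128 * (d' : ℝ) / N) := by
    refine le_of_hp hCH hn₂ hN0 (hHP _ _ (by omega) (by omega) (by omega)) ?_
    calc ((2 ^ (l + 2) + d' : ℕ) : ℝ) * N = ((2 ^ (l + 2) + d' : ℕ) : ℝ) * 2 * (N * 3) / 6 := by ring
      _ ≤ 3 * d' * (256 * ((2 ^ (K₂ - 1) - d' : ℕ) : ℝ)) / 6 := by
          apply div_le_div_of_nonneg_right _ (by norm_num)
          exact mul_le_mul hm1 hn₂' (by positivity) (by positivity)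
      _ = 128 * d' * ((2 ^ (K₂ - 1) - d' : ℕ) : ℝ) := by ring
  -- (1) the middle terms
  set C' : ℝ := 1152 * CH ^ 2 + 1344 * CH with hC'
  have hC'0 : 0 ≤ C' := by rw [hC']; positivity
  have hT₁ : ∀ k' ∈ Finset.Ico (l + 1) K₂,
      (if 2 ^ (l + 2) + 2 * d' + 1 ≤ 2 ^ (k' - 1) then B (2 ^ (l + 2) + d') (2 ^ (k' - 1) - d') else 1) *
        B (2 ^ (k' + 2) + d') (D - d') ≤
        (1 + 192 * CH) * (1 + C') * (((2 : ℝ) ^ k') ^ ε * ((d' : ℝ) ^ (1 - ε) / N)) := by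
    intro k' hk'
    rw [Finset.mem_Ico] at hk'
    have h2k : 2 ^ (l + 4) ≤ 2 ^ (k' + 3) := Nat.pow_le_pow_right (by norm_num) (by omega)
    have h2k' : 2 ^ (k' + 3) = 2 ^ k' * 8 := by rw [pow_add]; norm_num
    have h2k2 : 2 ^ (k' + 2) = 2 ^ k' * 4 := by rw [pow_add]; norm_num
    have hkK : 2 ^ (k' + 1) ≤ 2 ^ K₂ := Nat.pow_le_pow_right (by norm_num) (by omega)
    have h2k1' : 2 ^ (k' + 1) = 2 ^ k' * 2 := by rw [pow_succ]
    have hk0 : (0 : ℝ) < (2 : ℝ) ^ k' := by positivity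
    -- the outer pair
    have hB₂ : B (2 ^ (k' + 2) + d') (D - d') ≤ CH * (192 * (2 : ℝ) ^ k' / N) := by
      refine le_of_hp hCH hn₁ hN0 (hHP _ _ (by omega) (by omega) hDd) ?_
      have h1 : ((2 ^ (k' + 2) + d' : ℕ) : ℝ) ≤ 12 * (2 : ℝ) ^ k' := by
        have : 2 ^ (k' + 2) + d' ≤ 12 * 2 ^ k' := by omega
        exact_mod_cast this
      calc ((2 ^ (k' + 2) + d' : ℕ) : ℝ) * N ≤ (12 * (2 : ℝ) ^ k') * (16 * ((D - d' : ℕ) : ℝ)) :=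
            mul_le_mul h1 hn₁' hN0.le (by positivity)
        _ = 192 * (2 : ℝ) ^ k' * ((D - d' : ℕ) : ℝ) := by ring
    -- the product is `≤ min(192 C_H 2^{k'}, C' d') / N`
    have hprod : (if 2 ^ (l + 2) + 2 * d' + 1 ≤ 2 ^ (k' - 1) then B (2 ^ (l + 2) + d') (2 ^ (k' - 1) - d')
        else 1) * B (2 ^ (k' + 2) + d') (D - d') ≤ min (192 * CH * (2 : ℝ) ^ k') (C' * d') / N := by
      rw [le_div_iff₀ hN0, le_min_iff]
      by_cases hc : 2 ^ (l + 2) + 2 * d' + 1 ≤ 2 ^ (k' - 1)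
      · rw [if_pos hc]
        have hk'1 : 1 ≤ k' := by omega
        have h2k1 : 2 ^ k' = 2 ^ (k' - 1) * 2 := by
          rw [← pow_succ]; congr 1; omega
        -- the inner pair
        have hn₃ : (0 : ℝ) < ((2 ^ (k' - 1) - d' : ℕ) : ℝ) := by
          exact_mod_cast (show 0 < 2 ^ (k' - 1) - d' by omega)
        have hF₁ : B (2 ^ (l + 2) + d') (2 ^ (k' - 1) - d') ≤ CH * (6 * (d' : ℝ) / (2 : ℝ) ^ k') := by
          refine le_of_hp hCH hn₃ hk0 (hHP _ _ (by omega) (by omega) (by omega)) ?_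
          have h2 : (2 : ℝ) ^ k' ≤ 4 * ((2 ^ (k' - 1) - d' : ℕ) : ℝ) := by
            have : 2 ^ k' ≤ 4 * (2 ^ (k' - 1) - d') := by omega
            exact_mod_cast this
          calc ((2 ^ (l + 2) + d' : ℕ) : ℝ) * (2 : ℝ) ^ k'
              ≤ ((2 ^ (l + 2) + d' : ℕ) : ℝ) * (4 * ((2 ^ (k' - 1) - d' : ℕ) : ℝ)) :=
                mul_le_mul_of_nonneg_left h2 hm0
            _ = ((2 ^ (l + 2) + d' : ℕ) : ℝ) * 2 * (2 * ((2 ^ (k' - 1) - d' : ℕ) : ℝ)) := by ring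
            _ ≤ 3 * d' * (2 * ((2 ^ (k' - 1) - d' : ℕ) : ℝ)) := mul_le_mul_of_nonneg_right hm1 (by positivity)
            _ = 6 * d' * ((2 ^ (k' - 1) - d' : ℕ) : ℝ) := by ring
        constructor
        · calc B (2 ^ (l + 2) + d') (2 ^ (k' - 1) - d') * B (2 ^ (k' + 2) + d') (D - d') * N
              ≤ 1 * (CH * (192 * (2 : ℝ) ^ k' / N)) * N := by
                apply mul_le_mul_of_nonneg_right _ hN0.le
                exact mul_le_mul (hB1 _ _) hB₂ (hB0 _ _) zero_le_one
            _ = 192 * CH * (2 : ℝ) ^ k' := by field_simp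
        · calc B (2 ^ (l + 2) + d') (2 ^ (k' - 1) - d') * B (2 ^ (k' + 2) + d') (D - d') * N
              ≤ (CH * (6 * (d' : ℝ) / (2 : ℝ) ^ k')) * (CH * (192 * (2 : ℝ) ^ k' / N)) * N := by
                apply mul_le_mul_of_nonneg_right _ hN0.le
                exact mul_le_mul hF₁ hB₂ (hB0 _ _) (by positivity)
            _ = 1152 * CH ^ 2 * d' := by field_simp; ring
            _ ≤ C' * d' := by
                rw [hC']
                have : (0 : ℝ) ≤ 1344 * CH * d' := by positivity
                nlinarith
      · rw [if_neg hc, one_mul]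
        have hsmall : 2 ^ k' ≤ 7 * d' := by
          push Not at hc
          have : 2 ^ k' ≤ 2 ^ (k' - 1) * 2 := by
            rcases Nat.eq_zero_or_pos k' with h0 | h0
            · omega
            · rw [← pow_succ]; exact Nat.pow_le_pow_right (by norm_num) (by omega)
          omega
        have hsmall' : (2 : ℝ) ^ k' ≤ 7 * d' := by exact_mod_cast hsmall
        constructor
        · calc B (2 ^ (k' + 2) + d') (D - d') * N ≤ (CH * (192 * (2 : ℝ) ^ k' / N)) * N :=
              mul_le_mul_of_nonneg_right hB₂ hN0.le
            _ = 192 * CH * (2 : ℝ) ^ k' := by field_simp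
        · calc B (2 ^ (k' + 2) + d') (D - d') * N ≤ (CH * (192 * (2 : ℝ) ^ k' / N)) * N :=
              mul_le_mul_of_nonneg_right hB₂ hN0.le
            _ = 192 * CH * (2 : ℝ) ^ k' := by field_simp
            _ ≤ 192 * CH * (7 * d') := mul_le_mul_of_nonneg_left hsmall' (by positivity)
            _ = 1344 * CH * d' := by ring
            _ ≤ C' * d' := by
                rw [hC']
                have : (0 : ℝ) ≤ 1152 * CH ^ 2 * d' := by positivity
                nlinarith
    -- `min(a, b) ≤ a^ε b^{1-ε}`, `a^ε ≤ (1 + 192 C_H)(2^{k'})^ε`, `b^{1-ε} ≤ (1 + C') d'^{1-ε}`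
    have hmin := min_le_rpow_mul_rpow (a := 192 * CH * (2 : ℝ) ^ k') (b := C' * d') (by positivity)
      (by positivity) hε0.le hε1
    have ha : (192 * CH * (2 : ℝ) ^ k') ^ ε ≤ (1 + 192 * CH) * ((2 : ℝ) ^ k') ^ ε := by
      rw [Real.mul_rpow (by positivity) (by positivity)]
      exact mul_le_mul_of_nonneg_right (rpow_le_one_add (by positivity) hε0.le hε1)
        (Real.rpow_nonneg hk0.le _)
    have hb : (C' * (d' : ℝ)) ^ (1 - ε) ≤ (1 + C') * (d' : ℝ) ^ (1 - ε) := by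
      rw [Real.mul_rpow hC'0 hd0.le]
      exact mul_le_mul_of_nonneg_right (rpow_le_one_add hC'0 (by linarith) (by linarith))
        (Real.rpow_nonneg hd0.le _)
    calc _ ≤ min (192 * CH * (2 : ℝ) ^ k') (C' * d') / N := hprod
      _ ≤ (192 * CH * (2 : ℝ) ^ k') ^ ε * (C' * (d' : ℝ)) ^ (1 - ε) / N :=
          div_le_div_of_nonneg_right hmin hN0.le
      _ ≤ ((1 + 192 * CH) * ((2 : ℝ) ^ k') ^ ε) * ((1 + C') * (d' : ℝ) ^ (1 - ε)) / N := by
          apply div_le_div_of_nonneg_right _ hN0.le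
          exact mul_le_mul ha hb (Real.rpow_nonneg (by positivity) _) (by positivity)
      _ = (1 + 192 * CH) * (1 + C') * (((2 : ℝ) ^ k') ^ ε * ((d' : ℝ) ^ (1 - ε) / N)) := by ring
  -- summing the middle terms
  have hgeom := sum_two_rpow_Ico_le hε0 (l + 1) K₂
  have h2K : ((2 : ℝ) ^ K₂) ^ ε ≤ (N : ℝ) ^ ε :=
    Real.rpow_le_rpow (by positivity) (by exact_mod_cast (show 2 ^ K₂ ≤ N by omega)) hε0.le
  have hdN : (d' : ℝ) ^ (1 - ε) / N * (N : ℝ) ^ ε = ((d' : ℝ) / N) ^ (1 - ε) := by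
    rw [Real.div_rpow hd0.le hN0.le, div_mul_eq_mul_div, div_eq_div_iff (ne_of_gt hN0)
      (ne_of_gt (Real.rpow_pos_of_pos hN0 _))]
    rw [mul_assoc, ← Real.rpow_add hN0]
    simp
  have hsum : ∑ k' ∈ Finset.Ico (l + 1) K₂,
      (if 2 ^ (l + 2) + 2 * d' + 1 ≤ 2 ^ (k' - 1) then B (2 ^ (l + 2) + d') (2 ^ (k' - 1) - d') else 1) *
        B (2 ^ (k' + 2) + d') (D - d') ≤
      (1 + 192 * CH) * (1 + C') / ((2 : ℝ) ^ ε - 1) * ((d' : ℝ) / N) ^ (1 - ε) := by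
    calc _ ≤ ∑ k' ∈ Finset.Ico (l + 1) K₂,
          (1 + 192 * CH) * (1 + C') * (((2 : ℝ) ^ k') ^ ε * ((d' : ℝ) ^ (1 - ε) / N)) :=
          Finset.sum_le_sum hT₁
      _ = (1 + 192 * CH) * (1 + C') * ((d' : ℝ) ^ (1 - ε) / N) *
            ∑ k' ∈ Finset.Ico (l + 1) K₂, ((2 : ℝ) ^ k') ^ ε := by
          rw [Finset.mul_sum]; refine Finset.sum_congr rfl fun k' _ => ?_; ring
      _ ≤ (1 + 192 * CH) * (1 + C') * ((d' : ℝ) ^ (1 - ε) / N) * ((N : ℝ) ^ ε / ((2 : ℝ) ^ ε - 1)) := by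
          apply mul_le_mul_of_nonneg_left (hgeom.trans (div_le_div_of_nonneg_right h2K hx0.le))
          positivity
      _ = (1 + 192 * CH) * (1 + C') / ((2 : ℝ) ^ ε - 1) * ((d' : ℝ) ^ (1 - ε) / N * (N : ℝ) ^ ε) := by
          field_simp
      _ = _ := by rw [hdN]
  -- conclusion
  have hK0 : 0 ≤ (1 + 192 * CH) * (1 + C') / ((2 : ℝ) ^ ε - 1) := by positivity
  have hT₀' : B (2 ^ (l + 2) + d') (D - d') ≤ 24 * CH * ((d' : ℝ) / N) :=
    hT₀.trans (le_of_eq (by ring))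
  have hT₂' : B (2 ^ (l + 2) + d') (2 ^ (K₂ - 1) - d') ≤ 128 * CH * ((d' : ℝ) / N) :=
    hT₂.trans (le_of_eq (by ring))
  calc B (2 ^ (l + 2) + d') (D - d') + _ + B (2 ^ (l + 2) + d') (2 ^ (K₂ - 1) - d')
      ≤ 24 * CH * ((d' : ℝ) / N) + (1 + 192 * CH) * (1 + C') / ((2 : ℝ) ^ ε - 1) * ((d' : ℝ) / N) ^ (1 - ε) +
          128 * CH * ((d' : ℝ) / N) := add_le_add (add_le_add hT₀' hsum) hT₂'
    _ ≤ 24 * CH * ((d' : ℝ) / N) ^ (1 - ε) +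
          (1 + 192 * CH) * (1 + C') / ((2 : ℝ) ^ ε - 1) * ((d' : ℝ) / N) ^ (1 - ε) +
          128 * CH * ((d' : ℝ) / N) ^ (1 - ε) := by
        have h1 := mul_le_mul_of_nonneg_left hpow (show 0 ≤ 24 * CH by positivity)
        have h2 := mul_le_mul_of_nonneg_left hpow (show 0 ≤ 128 * CH by positivity)
        exact add_le_add (add_le_add h1 le_rfl) h2
    _ = _ := by rw [hC']; ring

/-- **The bracket of the shallow boundary layer is `O(N^{ε-1})`** (depth `d' < K₀`, base radius
`d₂ ≥ n₀`, base scale `k₀` with `n₀ ≤ 2^{k₀+2}`): there is `C = C(C_H, ε, d₂, k₀, K₀)` such that for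
`D = 2^{K₂+2}`, `16 · 2^{K₂} ≤ N < 2^{K₂+5}`, `k₀ < K₂`, `4(d₂ + K₀) ≤ 2^{K₂-1}` and the half-plane
pair bound `hHP` at `N`, the bracket of `boundary_pivotal_le_arc₂` is at most `C N^{ε-1}` (each
term of the sum over the scale of the defect is `≤ min(a 2^{k'}, b)/N` with `a, b` depending on
`C_H, k₀, d₂ + K₀` only, and `min(a 2^{k'}, b) ≤ (a 2^{k'})^ε b^{1-ε}` sums to `O(N^ε)`). [cite: Nolin2008, §4.6, Prop. 18 (the sum over the scale of the defect)] [cite: WernerPCMI2009, Lecture 6, proof of Lemma 6.2 (boundary contributions)] -/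
theorem bracket_shallow_le {CH ε : ℝ} {n₀ d₂ k₀ K₀ : ℕ} (hCH : 0 ≤ CH) (hε0 : 0 < ε) (hε1 : ε ≤ 1)
    (hd₂ : 1 ≤ d₂) (hn₀d : n₀ ≤ d₂) (hn₀k : n₀ ≤ 2 ^ (k₀ + 2)) :
    ∃ C : ℝ, 0 ≤ C ∧ ∀ (t : unitInterval) (N K₂ D d' : ℕ),
      D = 2 ^ (K₂ + 2) → 16 * 2 ^ K₂ ≤ N → N < 2 ^ (K₂ + 5) → k₀ < K₂ → d' < K₀ →
      4 * (d₂ + K₀) ≤ 2 ^ (K₂ - 1) →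
      (∀ m n : ℕ, n₀ ≤ m → m ≤ n → n ≤ N →
        (triSitePercolation t).real (domArmEvent ![true, false] m n upperHalfPlane) ≤
          CH * ((m : ℝ) / n)) →
      ∑ k' ∈ Finset.range K₂,
          (if d₂ + 2 * d' + 1 ≤ 2 ^ (k' - 1) then
            (triSitePercolation t).real
              (domArmEvent ![true, false] (d₂ + d') (2 ^ (k' - 1) - d') upperHalfPlane)
            else 1) *
          (triSitePercolation t).real
            (domArmEvent ![true, false] (2 ^ (max k' k₀ + 2) + d') (D - d') upperHalfPlane) +
        (triSitePercolation t).real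
          (domArmEvent ![true, false] (d₂ + d') (2 ^ (K₂ - 1) - d') upperHalfPlane) ≤
        C * (N : ℝ) ^ (ε - 1) := by
  set Q : ℝ := ((d₂ + K₀ : ℕ) : ℝ) with hQ
  set a : ℝ := 16 * CH * (2 : ℝ) ^ k₀ * (4 + Q) with ha
  set b : ℝ := 4 * CH * Q * a + 6 * a * Q with hb
  have hQ0 : 0 ≤ Q := by positivity
  have ha0 : 0 ≤ a := by positivity
  have hb0 : 0 ≤ b := by positivity
  have hx1 : (1 : ℝ) < (2 : ℝ) ^ ε := Real.one_lt_rpow (by norm_num) hε0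
  have hx0 : (0 : ℝ) < (2 : ℝ) ^ ε - 1 := by linarith
  refine ⟨128 * CH * Q + (1 + a) * (1 + b) / ((2 : ℝ) ^ ε - 1), by positivity, ?_⟩
  intro t N K₂ D d' hD hK₂N hNK₂ hk₀ hd' hroom hHP
  set Bf : ℕ → ℕ → ℝ := fun m n =>
    (triSitePercolation t).real (domArmEvent ![true, false] m n upperHalfPlane) with hBf
  have hB0 : ∀ m n, 0 ≤ Bf m n := fun m n => measureReal_nonneg
  have hB1 : ∀ m n, Bf m n ≤ 1 := fun m n => measureReal_le_one
  -- sizes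
  have hP3 : 1 ≤ 2 ^ (K₂ - 1) := Nat.one_le_two_pow
  have eK0 : 2 ^ K₂ = 2 ^ (K₂ - 1) * 2 := by rw [← pow_succ]; congr 1; omega
  have eK1 : 2 ^ (K₂ + 1) = 2 ^ (K₂ - 1) * 4 := by
    rw [show (4 : ℕ) = 2 ^ 2 by norm_num, ← pow_add]; congr 1; omega
  have eK2 : 2 ^ (K₂ + 2) = 2 ^ (K₂ - 1) * 8 := by
    rw [show (8 : ℕ) = 2 ^ 3 by norm_num, ← pow_add]; congr 1; omega
  have eK5 : 2 ^ (K₂ + 5) = 2 ^ (K₂ - 1) * 64 := by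
    rw [show (64 : ℕ) = 2 ^ 6 by norm_num, ← pow_add]; congr 1; omega
  have hk₀K : 2 ^ (k₀ + 2) ≤ 2 ^ (K₂ + 1) := Nat.pow_le_pow_right (by norm_num) (by omega)
  have hN0 : (0 : ℝ) < N := by exact_mod_cast (show 0 < N by omega)
  have hN1 : (1 : ℝ) ≤ N := by exact_mod_cast (show 1 ≤ N by omega)
  have hDd : D - d' ≤ N := by omega
  have hn₁ : (0 : ℝ) < ((D - d' : ℕ) : ℝ) := by exact_mod_cast (show 0 < D - d' by omega)
  have hn₁' : (N : ℝ) ≤ 16 * ((D - d' : ℕ) : ℝ) := by exact_mod_cast (show N ≤ 16 * (D - d') by omega)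
  have hqQ : ((d₂ + d' : ℕ) : ℝ) ≤ Q := by rw [hQ]; exact_mod_cast (show d₂ + d' ≤ d₂ + K₀ by omega)
  have hq0 : (0 : ℝ) ≤ ((d₂ + d' : ℕ) : ℝ) := by positivity
  have hd'Q : (d' : ℝ) ≤ Q := by rw [hQ]; exact_mod_cast (show d' ≤ d₂ + K₀ by omega)
  -- the terms of the sum are `≤ min(a 2^{k'}, b) / N`
  have hterm : ∀ k' ∈ Finset.range K₂,
      (if d₂ + 2 * d' + 1 ≤ 2 ^ (k' - 1) then Bf (d₂ + d') (2 ^ (k' - 1) - d') else 1) *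
        Bf (2 ^ (max k' k₀ + 2) + d') (D - d') ≤ min (a * (2 : ℝ) ^ k') b / N := by
    intro k' hk'
    rw [Finset.mem_range] at hk'
    have hk0 : (0 : ℝ) < (2 : ℝ) ^ k' := by positivity
    have hk1 : (1 : ℝ) ≤ (2 : ℝ) ^ k' := one_le_pow₀ (by norm_num)
    have hmax : 2 ^ (max k' k₀ + 2) ≤ 2 ^ (K₂ + 1) := Nat.pow_le_pow_right (by norm_num) (by omega)
    have hmax' : 2 ^ (k₀ + 2) ≤ 2 ^ (max k' k₀ + 2) := Nat.pow_le_pow_right (by norm_num) (by omega)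
    have emax : (2 : ℝ) ^ (max k' k₀ + 2) ≤ 4 * ((2 : ℝ) ^ k' * (2 : ℝ) ^ k₀) := by
      have h1 : 2 ^ max k' k₀ ≤ 2 ^ k' * 2 ^ k₀ := by
        rw [← pow_add]; exact Nat.pow_le_pow_right (by norm_num) (by omega)
      have h : 2 ^ (max k' k₀ + 2) ≤ 4 * (2 ^ k' * 2 ^ k₀) := by rw [pow_add]; omega
      exact_mod_cast h
    have hk'K : 2 ^ (k' - 1) ≤ 2 ^ (K₂ - 1) := Nat.pow_le_pow_right (by norm_num) (by omega)
    have hqQ' : (d₂ : ℝ) + d' ≤ Q := by have h := hqQ; push_cast at h; exact h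
    have h1k : (1 : ℝ) ≤ (2 : ℝ) ^ k' * (2 : ℝ) ^ k₀ :=
      one_le_mul_of_one_le_of_one_le hk1 (one_le_pow₀ (by norm_num))
    -- the outer pair: `≤ a 2^{k'} / N`
    have hB₂ : Bf (2 ^ (max k' k₀ + 2) + d') (D - d') ≤ a * (2 : ℝ) ^ k' / N := by
      refine le_div_of_hp hn₁ hN0 (hHP _ _ (by omega) (by omega) hDd) ?_
      have hm : ((2 ^ (max k' k₀ + 2) + d' : ℕ) : ℝ) ≤ (2 : ℝ) ^ k' * (2 : ℝ) ^ k₀ * (4 + Q) := by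
        push_cast
        have : (d' : ℝ) ≤ (2 : ℝ) ^ k' * (2 : ℝ) ^ k₀ * Q := by
          calc (d' : ℝ) = 1 * d' := (one_mul _).symm
            _ ≤ (2 : ℝ) ^ k' * (2 : ℝ) ^ k₀ * Q := mul_le_mul h1k hd'Q (by positivity) (by positivity)
        linarith [emax]
      calc CH * ((2 ^ (max k' k₀ + 2) + d' : ℕ) : ℝ) * N
          ≤ CH * ((2 : ℝ) ^ k' * (2 : ℝ) ^ k₀ * (4 + Q)) * (16 * ((D - d' : ℕ) : ℝ)) := by
            apply mul_le_mul (mul_le_mul_of_nonneg_left hm hCH) hn₁' hN0.le (by positivity)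
        _ = a * (2 : ℝ) ^ k' * ((D - d' : ℕ) : ℝ) := by rw [ha]; ring
    rw [le_div_iff₀ hN0, le_min_iff]
    by_cases hc : d₂ + 2 * d' + 1 ≤ 2 ^ (k' - 1)
    · rw [if_pos hc]
      have hk'1 : 1 ≤ k' := by
        rcases Nat.eq_zero_or_pos k' with h0 | h0
        · rw [h0] at hc; norm_num at hc; omega
        · exact h0
      have h2k1 : 2 ^ k' = 2 ^ (k' - 1) * 2 := by rw [← pow_succ]; congr 1; omega
      -- the inner pair: `≤ 4 C_H Q / 2^{k'}`
      have hn₃ : (0 : ℝ) < ((2 ^ (k' - 1) - d' : ℕ) : ℝ) := by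
        exact_mod_cast (show 0 < 2 ^ (k' - 1) - d' by omega)
      have hF₁ : Bf (d₂ + d') (2 ^ (k' - 1) - d') ≤ 4 * CH * Q / (2 : ℝ) ^ k' := by
        refine le_div_of_hp hn₃ hk0 (hHP _ _ (by omega) (by omega) (by omega)) ?_
        have h2 : (2 : ℝ) ^ k' ≤ 4 * ((2 ^ (k' - 1) - d' : ℕ) : ℝ) := by
          have : 2 ^ k' ≤ 4 * (2 ^ (k' - 1) - d') := by omega
          exact_mod_cast this
        calc CH * ((d₂ + d' : ℕ) : ℝ) * (2 : ℝ) ^ k' ≤ CH * Q * (4 * ((2 ^ (k' - 1) - d' : ℕ) : ℝ)) :=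
              mul_le_mul (mul_le_mul_of_nonneg_left hqQ hCH) h2 hk0.le (by positivity)
          _ = 4 * CH * Q * ((2 ^ (k' - 1) - d' : ℕ) : ℝ) := by ring
      constructor
      · calc Bf (d₂ + d') (2 ^ (k' - 1) - d') * Bf (2 ^ (max k' k₀ + 2) + d') (D - d') * N
            ≤ 1 * (a * (2 : ℝ) ^ k' / N) * N := by
              apply mul_le_mul_of_nonneg_right _ hN0.le
              exact mul_le_mul (hB1 _ _) hB₂ (hB0 _ _) zero_le_one
          _ = a * (2 : ℝ) ^ k' := by field_simp
      · calc Bf (d₂ + d') (2 ^ (k' - 1) - d') * Bf (2 ^ (max k' k₀ + 2) + d') (D - d') * N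
            ≤ (4 * CH * Q / (2 : ℝ) ^ k') * (a * (2 : ℝ) ^ k' / N) * N := by
              apply mul_le_mul_of_nonneg_right _ hN0.le
              exact mul_le_mul hF₁ hB₂ (hB0 _ _) (by positivity)
          _ = 4 * CH * Q * a := by field_simp
          _ ≤ b := by rw [hb]; nlinarith [ha0, hQ0]
    · rw [if_neg hc, one_mul]
      have hsmall : 2 ^ k' ≤ 6 * (d₂ + d') := by
        push Not at hc
        have : 2 ^ k' ≤ 2 ^ (k' - 1) * 2 := by
          rcases Nat.eq_zero_or_pos k' with h0 | h0
          · subst h0; norm_num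
          · rw [← pow_succ]; exact Nat.pow_le_pow_right (by norm_num) (by omega)
        omega
      have hsmall' : (2 : ℝ) ^ k' ≤ 6 * Q := by
        have : ((2 ^ k' : ℕ) : ℝ) ≤ 6 * ((d₂ + d' : ℕ) : ℝ) := by exact_mod_cast hsmall
        push_cast at this
        linarith [hqQ']
      constructor
      · calc Bf (2 ^ (max k' k₀ + 2) + d') (D - d') * N ≤ (a * (2 : ℝ) ^ k' / N) * N :=
            mul_le_mul_of_nonneg_right hB₂ hN0.le
          _ = a * (2 : ℝ) ^ k' := by field_simp
      · calc Bf (2 ^ (max k' k₀ + 2) + d') (D - d') * N ≤ (a * (2 : ℝ) ^ k' / N) * N :=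
            mul_le_mul_of_nonneg_right hB₂ hN0.le
          _ = a * (2 : ℝ) ^ k' := by field_simp
          _ ≤ a * (6 * Q) := mul_le_mul_of_nonneg_left hsmall' ha0
          _ = 6 * a * Q := by ring
          _ ≤ b := by rw [hb]; nlinarith [ha0, hQ0, hCH]
  -- summing: `min(a 2^{k'}, b) ≤ (a 2^{k'})^ε b^{1-ε} ≤ (1 + a)(1 + b) (2^{k'})^ε`
  have hterm' : ∀ k' ∈ Finset.range K₂,
      (if d₂ + 2 * d' + 1 ≤ 2 ^ (k' - 1) then Bf (d₂ + d') (2 ^ (k' - 1) - d') else 1) *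
        Bf (2 ^ (max k' k₀ + 2) + d') (D - d') ≤ (1 + a) * (1 + b) / N * ((2 : ℝ) ^ k') ^ ε := by
    intro k' hk'
    have hk0 : (0 : ℝ) ≤ (2 : ℝ) ^ k' := by positivity
    have hmin := min_le_rpow_mul_rpow (a := a * (2 : ℝ) ^ k') (b := b) (by positivity) hb0 hε0.le hε1
    have h1 : (a * (2 : ℝ) ^ k') ^ ε ≤ (1 + a) * ((2 : ℝ) ^ k') ^ ε := by
      rw [Real.mul_rpow ha0 hk0]
      exact mul_le_mul_of_nonneg_right (rpow_le_one_add ha0 hε0.le hε1) (Real.rpow_nonneg hk0 _)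
    have h2 : b ^ (1 - ε) ≤ 1 + b := rpow_le_one_add hb0 (by linarith) (by linarith)
    calc _ ≤ min (a * (2 : ℝ) ^ k') b / N := hterm k' hk'
      _ ≤ (a * (2 : ℝ) ^ k') ^ ε * b ^ (1 - ε) / N := div_le_div_of_nonneg_right hmin hN0.le
      _ ≤ ((1 + a) * ((2 : ℝ) ^ k') ^ ε) * (1 + b) / N := by
          apply div_le_div_of_nonneg_right _ hN0.le
          exact mul_le_mul h1 h2 (Real.rpow_nonneg hb0 _) (by positivity)
      _ = (1 + a) * (1 + b) / N * ((2 : ℝ) ^ k') ^ ε := by ring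
  have hgeom := sum_two_rpow_Ico_le hε0 0 K₂
  rw [Finset.range_eq_Ico] at hterm' ⊢
  have h2K : ((2 : ℝ) ^ K₂) ^ ε ≤ (N : ℝ) ^ ε :=
    Real.rpow_le_rpow (by positivity) (by exact_mod_cast (show 2 ^ K₂ ≤ N by omega)) hε0.le
  have hsum : ∑ k' ∈ Finset.Ico 0 K₂,
      (if d₂ + 2 * d' + 1 ≤ 2 ^ (k' - 1) then Bf (d₂ + d') (2 ^ (k' - 1) - d') else 1) *
        Bf (2 ^ (max k' k₀ + 2) + d') (D - d') ≤ (1 + a) * (1 + b) / ((2 : ℝ) ^ ε - 1) * ((N : ℝ) ^ ε / N) := by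
    calc _ ≤ ∑ k' ∈ Finset.Ico 0 K₂, (1 + a) * (1 + b) / N * ((2 : ℝ) ^ k') ^ ε := Finset.sum_le_sum hterm'
      _ = (1 + a) * (1 + b) / N * ∑ k' ∈ Finset.Ico 0 K₂, ((2 : ℝ) ^ k') ^ ε := by rw [Finset.mul_sum]
      _ ≤ (1 + a) * (1 + b) / N * ((N : ℝ) ^ ε / ((2 : ℝ) ^ ε - 1)) := by
          apply mul_le_mul_of_nonneg_left (hgeom.trans (div_le_div_of_nonneg_right h2K hx0.le))
          positivity
      _ = _ := by field_simp
  -- the last term: `≤ 128 C_H Q / N`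
  have hn₂ : (0 : ℝ) < ((2 ^ (K₂ - 1) - d' : ℕ) : ℝ) := by
    exact_mod_cast (show 0 < 2 ^ (K₂ - 1) - d' by omega)
  have hlast : Bf (d₂ + d') (2 ^ (K₂ - 1) - d') ≤ 128 * CH * Q / N := by
    refine le_div_of_hp hn₂ hN0 (hHP _ _ (by omega) (by omega) (by omega)) ?_
    have h2 : (N : ℝ) ≤ 128 * ((2 ^ (K₂ - 1) - d' : ℕ) : ℝ) := by
      exact_mod_cast (show N ≤ 128 * (2 ^ (K₂ - 1) - d') by omega)
    calc CH * ((d₂ + d' : ℕ) : ℝ) * N ≤ CH * Q * (128 * ((2 ^ (K₂ - 1) - d' : ℕ) : ℝ)) :=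
          mul_le_mul (mul_le_mul_of_nonneg_left hqQ hCH) h2 hN0.le (by positivity)
      _ = 128 * CH * Q * ((2 ^ (K₂ - 1) - d' : ℕ) : ℝ) := by ring
  -- `1/N ≤ N^{ε-1}`, `N^ε / N = N^{ε-1}`
  have hNε : (N : ℝ) ^ ε / N = (N : ℝ) ^ (ε - 1) := by
    rw [Real.rpow_sub_one (ne_of_gt hN0)]
  have hNinv : 1 / (N : ℝ) ≤ (N : ℝ) ^ (ε - 1) := by
    rw [← hNε]
    exact div_le_div_of_nonneg_right (Real.one_le_rpow hN1 hε0.le) hN0.le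
  calc _ ≤ (1 + a) * (1 + b) / ((2 : ℝ) ^ ε - 1) * ((N : ℝ) ^ ε / N) + 128 * CH * Q / N :=
        add_le_add hsum hlast
    _ = (1 + a) * (1 + b) / ((2 : ℝ) ^ ε - 1) * ((N : ℝ) ^ ε / N) + 128 * CH * Q * (1 / N) := by ring
    _ ≤ (1 + a) * (1 + b) / ((2 : ℝ) ^ ε - 1) * (N : ℝ) ^ (ε - 1) + 128 * CH * Q * (N : ℝ) ^ (ε - 1) := by
        rw [hNε]
        exact add_le_add le_rfl (mul_le_mul_of_nonneg_left hNinv (by positivity))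
    _ = _ := by ring

end Numerics

/-! ### Two factors: the inner host event and the local event -/

section TwoFactor

variable {a b r₀ N R₁ l : ℕ} {v : Site 2}

/-- **Inner host event and local event only** (the outer factor dropped): for `l ≥ 1`,
`r₀ + 2·2^l ≤ |v|_𝕋 ≤ N - 2·2^l`, `r₀ ≤ R₁`, `R₁ + 2^l < |v|_𝕋`:
`P_t(v pivotal for arcFourArm a b r₀ N) ≤ P_t(innerArcFourArm a b r₀ R₁) · (L^alt_T(l) + L^alt_F(l))`.
[cite: WernerPCMI2009, Lecture 6, §5 (the three annuli; the outer one dropped)] [cite: Nolin2008, §6.2, proof of Thm. 27, Case 3 (arXiv 0711.4948: Thm. 26)] -/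
theorem measureReal_isPivotal_arcFourArm_le₂ (t : unitInterval) (hl : 1 ≤ l)
    (hvr : (r₀ : ℤ) + 2 * 2 ^ l ≤ triNorm v) (hvN : triNorm v + 2 * 2 ^ l ≤ N) (hR₀ : r₀ ≤ R₁)
    (hR₁v : (R₁ : ℤ) + 2 ^ l < triNorm v) (hR₁N : R₁ ≤ N) :
    (triSitePercolation t).real {ω | IsPivotal (arcFourArm a b r₀ N) v ω} ≤
      (triSitePercolation t).real (innerArcFourArm a b r₀ R₁) *
        ∑ c : Bool, (altFourArmProbAt t 1 (2 ^ (l - 1)) +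
          altFourArmProbAt t 2 (2 ^ l) * (triSitePercolation t).real (armEvent ![c] 2 (2 ^ l)) +
          ∑ l' ∈ Finset.Ico 1 l, altFourArmProbAt t 1 (2 ^ (l' - 1)) *
            (altFourArmProbAt t (2 ^ (l' + 1)) (2 ^ l) *
              (triSitePercolation t).real (armEvent ![c] (2 ^ (l' + 1)) (2 ^ l)))) := by
  classical
  set μ := triSitePercolation t with hμ
  set E := arcFourArm a b r₀ N with hE
  set In := innerArcFourArm a b r₀ R₁ with hIn
  have hInF : DeterminedBy In ↑(triAnnulus r₀ R₁) := determinedBy_innerArcFourArm hR₀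
  have hOutF : DeterminedBy (univ : Set (SiteConfig (Site 2))) ↑(∅ : Finset (Site 2)) :=
    determinedBy_univ _
  have hFIn : ∀ z ∈ triAnnulus r₀ R₁, triNorm z + 2 ^ l < triNorm v := fun z hz => by
    rw [mem_triAnnulus] at hz; omega
  set S : Bool → Set (SiteConfig (Site 2)) := fun c => {ω | IsPivotal E v ω ∧
    SiteConfig.relabel (triShiftIso (-v)).toEquiv ω ∈
      (altFourArm 1 (2 ^ (l - 1)) ∪
        (altFourArm 2 (2 ^ l) □ armEvent ![c] 2 (2 ^ l))) ∪
        ⋃ l' ∈ Finset.Ico 1 l, (altFourArm 1 (2 ^ (l' - 1)) ∩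
          (altFourArm (2 ^ (l' + 1)) (2 ^ l) □ armEvent ![c] (2 ^ (l' + 1)) (2 ^ l)))} with hS
  have hsub : {ω | IsPivotal E v ω} ⊆ S true ∪ S false := by
    intro ω hω
    obtain ⟨c, hc⟩ := isPivotal_arcFourArm_subset_localAlt hl hvr hvN hω
    cases c
    · exact Or.inr ⟨hω, hc⟩
    · exact Or.inl ⟨hω, hc⟩
  have hSle : ∀ c : Bool, μ.real (S c) ≤ μ.real In * μ.real (univ : Set (SiteConfig (Site 2))) *
      (altFourArmProbAt t 1 (2 ^ (l - 1)) +
        altFourArmProbAt t 2 (2 ^ l) * μ.real (armEvent ![c] 2 (2 ^ l)) +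
        ∑ l' ∈ Finset.Ico 1 l, altFourArmProbAt t 1 (2 ^ (l' - 1)) *
          (altFourArmProbAt t (2 ^ (l' + 1)) (2 ^ l) *
            μ.real (armEvent ![c] (2 ^ (l' + 1)) (2 ^ l)))) := fun c =>
    measureReal_le_of_subset_localAlt_gen t c hl (S := S c) hInF hOutF hFIn
      (Finset.disjoint_empty_right _) (fun _ => Finset.disjoint_empty_left _)
      (fun ω hω => isPivotal_arcFourArm_subset_inner hR₀ hR₁N
        (by have : (0 : ℤ) < 2 ^ l := by positivity
            omega) hω.1)
      (fun ω _ => mem_univ _) (fun ω hω => hω.2)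
  have huniv : μ.real (univ : Set (SiteConfig (Site 2))) = 1 := probReal_univ
  calc μ.real {ω | IsPivotal E v ω} ≤ μ.real (S true ∪ S false) :=
        measureReal_mono hsub (measure_ne_top _ _)
    _ ≤ μ.real (S true) + μ.real (S false) := measureReal_union_le _ _
    _ ≤ _ := by
        rw [Fintype.sum_bool, mul_add]
        have h1 := hSle true
        have h2 := hSle false
        rw [huniv, mul_one] at h1 h2
        exact add_le_add h1 h2

end TwoFactor

/-! ### The five regimes -/

section Regimes

variable {t : unitInterval} {a b r₀ r rL rH N l₁ : ℕ} {cQ cL cH cE Kl β : ℝ}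

/-- The local factor `Σ_c L^alt_c(l)`, as it appears in the per-site bounds. [folklore] -/
private theorem sum_local_le
    (hLoc : ∀ (c : Bool) (l : ℕ), l₁ + 2 ≤ l → 2 ^ (l + 2) ≤ N →
      altFourArmProbAt t 1 (2 ^ (l - 1)) +
          altFourArmProbAt t 2 (2 ^ l) * (triSitePercolation t).real (armEvent ![c] 2 (2 ^ l)) +
          ∑ l' ∈ Finset.Ico 1 l, altFourArmProbAt t 1 (2 ^ (l' - 1)) *
            (altFourArmProbAt t (2 ^ (l' + 1)) (2 ^ l) *
              (triSitePercolation t).real (armEvent ![c] (2 ^ (l' + 1)) (2 ^ l))) ≤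
        Kl * altFourArmProbAt t r (2 ^ l))
    {l : ℕ} (hl : l₁ + 2 ≤ l) (hlN : 2 ^ (l + 2) ≤ N) :
    ∑ c : Bool, (altFourArmProbAt t 1 (2 ^ (l - 1)) +
        altFourArmProbAt t 2 (2 ^ l) * (triSitePercolation t).real (armEvent ![c] 2 (2 ^ l)) +
        ∑ l' ∈ Finset.Ico 1 l, altFourArmProbAt t 1 (2 ^ (l' - 1)) *
          (altFourArmProbAt t (2 ^ (l' + 1)) (2 ^ l) *
            (triSitePercolation t).real (armEvent ![c] (2 ^ (l' + 1)) (2 ^ l)))) ≤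
      2 * Kl * altFourArmProbAt t r (2 ^ l) := by
  rw [Fintype.sum_bool]
  have h1 := hLoc true l hl hlN
  have h2 := hLoc false l hl hlN
  linarith

/-- **The kernel ratio bound at a dyadic scale**: `π̂^alt(r, 2^l) ≤ π̂^alt(r₀, 2^l) ≤
(4/(c_Q c_L)) (N/2^l)^{2-β} π̂^alt(r₀, N)` (`r ≤ r₀`, quasi-multiplicativity and the lower bound). [cite: WernerPCMI2009, Lecture 6, §5] -/
theorem alt_dyadic_le (hcQ : 0 < cQ) (hcL : 0 < cL) (hβ : 0 < β) (hβ2 : β ≤ 2)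
    (hQ : ∀ R S : ℕ, 16 * r₀ < 4 * R → 4 * R < S → S ≤ N →
      cQ * (altFourArmProbAt t r₀ R * altFourArmProbAt t (4 * R) S) ≤ altFourArmProbAt t r₀ S)
    (hL : ∀ m n : ℕ, rL ≤ m → m ≤ n → n ≤ N → cL * ((m : ℝ) / n) ^ (2 - β) ≤ altFourArmProbAt t m n)
    (hrr₀ : r ≤ r₀) (hNr : 20 * r₀ + 10 ≤ N) (hNL : 5 * rL + 5 ≤ N) {d : ℕ} (hd : 4 * r₀ + 1 ≤ d)
    (hd' : rL ≤ d) (hdN : d ≤ N) :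
    altFourArmProbAt t r d ≤ 4 / (cQ * cL) * ((N : ℝ) / d) ^ (2 - β) * altFourArmProbAt t r₀ N :=
  (altFourArmProbAt_mono_left t hrr₀ (by omega)).trans
    (kernel_le_ratio_mul (q := fun r R => altFourArmProbAt t r R)
      (fun r R => altFourArmProbAt_nonneg t r R) (fun r R R' h h' => altFourArmProbAt_anti t r h h')
      hcQ hcL hβ hβ2 hQ hL hNr hNL hd hd' hdN)

/-- **Small distances** (`r₀ ≤ |v|_𝕋 = k < K₀`): only the outer arms are kept
(`isPivotal_arcFourArm_subset_outer`): `P_t(v pivotal) ≤ P_t(outerArc(k+1, N)) ≤ P_t(outerArc(8K₀, N))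
≤ P_t(E)/(c_H P_t(innerArc(r₀, K₀)))` by the host gluing, `P_t(innerArc(r₀, K₀)) ≥ (t(1-t))^{2(K₀+1-r₀)} ≥ (3/16)^{2(K₀+1-r₀)}`
by the explicit rays (`arcFourArm_lowerBound`, `1/2 ≤ t ≤ 3/4`), and `1 ≤ N² π̂^alt_t(r₀, N)/c_L`:
`P_t(v pivotal) ≤ ((16/3)^{2(K₀+1-r₀)}/(c_H c_L)) · N² π̂^alt_t(r₀, N) · P_t(E)`. [cite: WernerPCMI2009, Lecture 6, §5 (the O(1) sites near the inner hexagon)] [cite: Nolin2008, §6.2 (the terms k ≤ k₀ + 3)] -/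
theorem arc_pivotal_small (hab : (a = 0 ∧ b = 3) ∨ (a = 3 ∧ b = 0)) (hcL : 0 < cL) (hcH : 0 < cH)
    (hβ : 0 < β) (ht : 1 / 2 ≤ (t : ℝ)) (ht' : (t : ℝ) ≤ 3 / 4)
    (hL : ∀ m n : ℕ, rL ≤ m → m ≤ n → n ≤ N → cL * ((m : ℝ) / n) ^ (2 - β) ≤ altFourArmProbAt t m n)
    (hHost : ∀ m m' : ℕ, rH ≤ m → m' ≤ 8 * m → 16 * m + 1024 ≤ N →
      cH * ((triSitePercolation t).real (innerArcFourArm a b r₀ m) *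
        (triSitePercolation t).real (outerArcFourArm a b m' N)) ≤
        (triSitePercolation t).real (arcFourArm a b r₀ N))
    {K₀ : ℕ} (hr₀ : 1 ≤ r₀) (hrL : rL ≤ r₀) (hK₀ : r₀ ≤ K₀) (hrH : rH ≤ K₀) (hN : 16 * K₀ + 1024 ≤ N)
    {v : Site 2} {k : ℕ} (hk : triNorm v = k) (hr₀k : r₀ ≤ k) (hkK : k < K₀) :
    (triSitePercolation t).real {ω | IsPivotal (arcFourArm a b r₀ N) v ω} ≤
      ((16 / 3 : ℝ) ^ (2 * (K₀ + 1 - r₀)) / (cH * cL)) *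
        (((N : ℝ) ^ 2 * altFourArmProbAt t r₀ N) * (triSitePercolation t).real (arcFourArm a b r₀ N)) := by
  set μ := triSitePercolation t with hμ
  set P : ℝ := μ.real (arcFourArm a b r₀ N) with hP
  set c₀ : ℝ := ((t : ℝ) * (1 - t)) ^ (2 * (K₀ + 1 - r₀)) with hc₀
  -- outer arms
  have h1 : μ.real {ω | IsPivotal (arcFourArm a b r₀ N) v ω} ≤ μ.real (outerArcFourArm a b (8 * K₀) N) := by
    refine (measureReal_mono (isPivotal_arcFourArm_subset_outer (R₂ := k + 1) (by omega) (by omega)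
      (by rw [hk]; omega)) (measure_ne_top _ _)).trans ?_
    exact measureReal_mono (outerArcFourArm_mono_left a b (by omega) (by omega)) (measure_ne_top _ _)
  -- host gluing with the explicit inner piece
  have h2 := hHost K₀ (8 * K₀) hrH le_rfl hN
  have h3 : c₀ ≤ μ.real (innerArcFourArm a b r₀ K₀) :=
    (arcFourArm_lowerBound t hab hr₀ hK₀).trans
      (measureReal_mono (arcFourArm_subset_inner a b r₀ K₀) (measure_ne_top _ _))
  have htt : (3 / 16 : ℝ) ≤ (t : ℝ) * (1 - t) := by nlinarith
  have hc₀pos : 0 < c₀ := by rw [hc₀]; exact pow_pos (lt_of_lt_of_le (by norm_num) htt) _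
  have hc₀ge : (3 / 16 : ℝ) ^ (2 * (K₀ + 1 - r₀)) ≤ c₀ := pow_le_pow_left₀ (by norm_num) htt _
  have h4 : μ.real (outerArcFourArm a b (8 * K₀) N) ≤ P / (cH * c₀) := by
    rw [le_div_iff₀ (mul_pos hcH hc₀pos)]
    calc μ.real (outerArcFourArm a b (8 * K₀) N) * (cH * c₀)
        = cH * (c₀ * μ.real (outerArcFourArm a b (8 * K₀) N)) := by ring
      _ ≤ cH * (μ.real (innerArcFourArm a b r₀ K₀) * μ.real (outerArcFourArm a b (8 * K₀) N)) :=
          mul_le_mul_of_nonneg_left (mul_le_mul_of_nonneg_right h3 measureReal_nonneg) hcH.le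
      _ ≤ P := h2
  -- `1 ≤ N² π̂ / c_L`
  have h5 := cL_le_sq_mul_alt hcL hβ hL hr₀ hrL (by omega)
  have hP0 : 0 ≤ P := measureReal_nonneg
  have h6 : P / (cH * c₀) ≤ (16 / 3 : ℝ) ^ (2 * (K₀ + 1 - r₀)) / (cH * cL) *
      (((N : ℝ) ^ 2 * altFourArmProbAt t r₀ N) * P) := by
    have hinv : 1 / c₀ ≤ (16 / 3 : ℝ) ^ (2 * (K₀ + 1 - r₀)) := by
      rw [div_le_iff₀ hc₀pos]
      calc (1 : ℝ) = (16 / 3 : ℝ) ^ (2 * (K₀ + 1 - r₀)) * (3 / 16 : ℝ) ^ (2 * (K₀ + 1 - r₀)) := by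
            rw [← mul_pow]; norm_num
        _ ≤ _ := mul_le_mul_of_nonneg_left hc₀ge (by positivity)
    calc P / (cH * c₀) = (1 / c₀) * (1 / cH) * P := by field_simp
      _ ≤ (16 / 3 : ℝ) ^ (2 * (K₀ + 1 - r₀)) * (1 / cH) * P := by
          apply mul_le_mul_of_nonneg_right _ hP0
          exact mul_le_mul_of_nonneg_right hinv (by positivity)
      _ = (16 / 3 : ℝ) ^ (2 * (K₀ + 1 - r₀)) / (cH * cL) * (cL * P) := by field_simp
      _ ≤ (16 / 3 : ℝ) ^ (2 * (K₀ + 1 - r₀)) / (cH * cL) * (((N : ℝ) ^ 2 * altFourArmProbAt t r₀ N) * P) := by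
          apply mul_le_mul_of_nonneg_left _ (by positivity)
          exact mul_le_mul_of_nonneg_right h5 hP0
  exact h1.trans (h4.trans h6)

/-- **The bulk** (`K₀ ≤ |v|_𝕋 = k`, `16k + 1024 ≤ N`): the three annuli with the box `2^l`,
`k/64 < 2^l ≤ k/32`, `R₁ = k - 2^l - 1`, `R₂ = k + 2^l + 1` (`measureReal_isPivotal_arcFourArm_le`),
host gluing `c_H P(innerArc(r₀, R₁)) P(outerArc(R₂, N)) ≤ P(E)`, the local factor bound and the kernel
ratio bound: `P_t(v pivotal) ≤ (32768 K_l/(c_H c_Q c_L)) (N/k)^{2-β} π̂^alt_t(r₀, N) P_t(E)`. [cite: WernerPCMI2009, Lecture 6, §5] [cite: Nolin2008, §6.2, proof of Thm. 27, Case 3] -/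
theorem arc_pivotal_inner (hcQ : 0 < cQ) (hcL : 0 < cL) (hcH : 0 < cH) (hKl : 0 ≤ Kl) (hβ : 0 < β)
    (hβ2 : β ≤ 2)
    (hQ : ∀ R S : ℕ, 16 * r₀ < 4 * R → 4 * R < S → S ≤ N →
      cQ * (altFourArmProbAt t r₀ R * altFourArmProbAt t (4 * R) S) ≤ altFourArmProbAt t r₀ S)
    (hL : ∀ m n : ℕ, rL ≤ m → m ≤ n → n ≤ N → cL * ((m : ℝ) / n) ^ (2 - β) ≤ altFourArmProbAt t m n)
    (hLoc : ∀ (c : Bool) (l : ℕ), l₁ + 2 ≤ l → 2 ^ (l + 2) ≤ N →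
      altFourArmProbAt t 1 (2 ^ (l - 1)) +
          altFourArmProbAt t 2 (2 ^ l) * (triSitePercolation t).real (armEvent ![c] 2 (2 ^ l)) +
          ∑ l' ∈ Finset.Ico 1 l, altFourArmProbAt t 1 (2 ^ (l' - 1)) *
            (altFourArmProbAt t (2 ^ (l' + 1)) (2 ^ l) *
              (triSitePercolation t).real (armEvent ![c] (2 ^ (l' + 1)) (2 ^ l))) ≤
        Kl * altFourArmProbAt t r (2 ^ l))
    (hHost : ∀ m m' : ℕ, rH ≤ m → m' ≤ 8 * m → 16 * m + 1024 ≤ N →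
      cH * ((triSitePercolation t).real (innerArcFourArm a b r₀ m) *
        (triSitePercolation t).real (outerArcFourArm a b m' N)) ≤
        (triSitePercolation t).real (arcFourArm a b r₀ N))
    (hrr₀ : r ≤ r₀) (hr₀ : 1 ≤ r₀) (hNr : 20 * r₀ + 10 ≤ N) (hNL : 5 * rL + 5 ≤ N)
    {v : Site 2} {k : ℕ} (hk : triNorm v = k) (hk1 : 256 * 2 ^ l₁ ≤ k) (hk2 : 64 * (4 * r₀ + 1) ≤ k)
    (hk3 : 64 * rL ≤ k) (hk4 : 2 * rH + 2 ≤ k) (hk5 : 128 ≤ k) (hkN : 16 * k + 1024 ≤ N) :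
    (triSitePercolation t).real {ω | IsPivotal (arcFourArm a b r₀ N) v ω} ≤
      32768 * Kl / (cH * cQ * cL) * ((N : ℝ) / k) ^ (2 - β) *
        (altFourArmProbAt t r₀ N * (triSitePercolation t).real (arcFourArm a b r₀ N)) := by
  set μ := triSitePercolation t with hμ
  set P : ℝ := μ.real (arcFourArm a b r₀ N) with hP
  -- the box `2^l`, `k/64 < 2^l ≤ k/32`
  set l : ℕ := Nat.log 2 (k / 32) with hl
  have hk32 : k / 32 ≠ 0 := by omega
  have hlow : 2 ^ l ≤ k / 32 := Nat.pow_log_le_self 2 hk32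
  have hupp : k / 32 < 2 ^ (l + 1) := Nat.lt_pow_succ_log_self (by norm_num) _
  have h2l1 : 2 ^ (l + 1) = 2 ^ l * 2 := by rw [pow_succ]
  have h2l2 : 2 ^ (l + 2) = 2 ^ l * 4 := by rw [pow_add]; norm_num
  have hl₁ : l₁ + 2 ≤ l := by
    have h : 2 ^ (l₁ + 2) < 2 ^ (l + 1) := by
      have : 2 ^ (l₁ + 2) = 2 ^ l₁ * 4 := by rw [pow_add]; norm_num
      omega
    have := (Nat.pow_lt_pow_iff_right (by norm_num : 1 < 2)).1 h
    omega
  have hl1 : 1 ≤ l := by omega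
  set d : ℕ := 2 ^ l with hd
  have hd1 : 1 ≤ d := Nat.one_le_two_pow
  set R₁ : ℕ := k - d - 1 with hR₁
  set R₂ : ℕ := k + d + 1 with hR₂
  have hk0 : (0 : ℝ) < k := by exact_mod_cast (show 0 < k by omega)
  have hN0 : (0 : ℝ) < N := by exact_mod_cast (show 0 < N by omega)
  have hd0 : (0 : ℝ) < d := by exact_mod_cast (show 0 < d by omega)
  have hexp : (0 : ℝ) ≤ 2 - β := by linarith
  have hcast : ((2 ^ l : ℕ) : ℤ) = (2 : ℤ) ^ l := by push_cast; ring
  have h1 := measureReal_isPivotal_arcFourArm_le (a := a) (b := b) (r₀ := r₀) (N := N) (R₁ := R₁)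
    (R₂ := R₂) t hl1 (v := v)
    (by rw [hk, ← hcast]; exact_mod_cast (show r₀ + 2 * d ≤ k by omega))
    (by rw [hk, ← hcast]; exact_mod_cast (show k + 2 * d ≤ N by omega))
    (show r₀ ≤ R₁ by omega)
    (by rw [hk, ← hcast]; exact_mod_cast (show R₁ + d < k by omega))
    (by rw [hk, ← hcast]; exact_mod_cast (show k + d < R₂ by omega))
    (show R₂ ≤ N by omega)
  have h2 := hHost R₁ R₂ (by omega) (by omega) (by omega)
  have h3 := sum_local_le (r := r) hLoc hl₁ (by omega)
  have h4 := alt_dyadic_le hcQ hcL hβ hβ2 hQ hL hrr₀ hNr hNL (d := d) (by omega) (by omega) (by omega)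
  have h5 : ((N : ℝ) / d) ^ (2 - β) ≤ 4096 * ((N : ℝ) / k) ^ (2 - β) := by
    have hle : (N : ℝ) / d ≤ 64 * ((N : ℝ) / k) := by
      rw [div_le_iff₀ hd0, mul_div_assoc', div_mul_eq_mul_div, le_div_iff₀ hk0]
      have hdk : (k : ℝ) ≤ 64 * d := by exact_mod_cast (show k ≤ 64 * d by omega)
      nlinarith
    calc ((N : ℝ) / d) ^ (2 - β) ≤ (64 * ((N : ℝ) / k)) ^ (2 - β) :=
          Real.rpow_le_rpow (by positivity) hle hexp
      _ = (64 : ℝ) ^ (2 - β) * ((N : ℝ) / k) ^ (2 - β) := Real.mul_rpow (by norm_num) (by positivity)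
      _ ≤ (64 : ℝ) ^ (2 : ℝ) * ((N : ℝ) / k) ^ (2 - β) := by
          apply mul_le_mul_of_nonneg_right _ (by positivity)
          exact Real.rpow_le_rpow_of_exponent_le (by norm_num) (by linarith)
      _ = 4096 * ((N : ℝ) / k) ^ (2 - β) := by norm_num
  have hqN : 0 ≤ altFourArmProbAt t r₀ N := altFourArmProbAt_nonneg t r₀ N
  have hio : μ.real (innerArcFourArm a b r₀ R₁) * μ.real (outerArcFourArm a b R₂ N) ≤ P / cH := by
    rw [le_div_iff₀ hcH, mul_comm]; exact h2
  have hloc : ∑ c : Bool, (altFourArmProbAt t 1 (2 ^ (l - 1)) +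
      altFourArmProbAt t 2 (2 ^ l) * μ.real (armEvent ![c] 2 (2 ^ l)) +
      ∑ l' ∈ Finset.Ico 1 l, altFourArmProbAt t 1 (2 ^ (l' - 1)) *
        (altFourArmProbAt t (2 ^ (l' + 1)) (2 ^ l) * μ.real (armEvent ![c] (2 ^ (l' + 1)) (2 ^ l)))) ≤
      2 * Kl * (4 / (cQ * cL) * (4096 * ((N : ℝ) / k) ^ (2 - β)) * altFourArmProbAt t r₀ N) := by
    refine h3.trans (mul_le_mul_of_nonneg_left (h4.trans ?_) (by positivity))
    apply mul_le_mul_of_nonneg_right _ hqN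
    exact mul_le_mul_of_nonneg_left h5 (by positivity)
  have hloc0 : 0 ≤ ∑ c : Bool, (altFourArmProbAt t 1 (2 ^ (l - 1)) +
      altFourArmProbAt t 2 (2 ^ l) * μ.real (armEvent ![c] 2 (2 ^ l)) +
      ∑ l' ∈ Finset.Ico 1 l, altFourArmProbAt t 1 (2 ^ (l' - 1)) *
        (altFourArmProbAt t (2 ^ (l' + 1)) (2 ^ l) * μ.real (armEvent ![c] (2 ^ (l' + 1)) (2 ^ l)))) := by
    refine Finset.sum_nonneg fun c _ => ?_
    have := altFourArmProbAt_nonneg t 1 (2 ^ (l - 1))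
    have := altFourArmProbAt_nonneg t 2 (2 ^ l)
    refine add_nonneg (add_nonneg (altFourArmProbAt_nonneg _ _ _)
      (mul_nonneg (altFourArmProbAt_nonneg _ _ _) measureReal_nonneg)) (Finset.sum_nonneg fun l' _ => ?_)
    exact mul_nonneg (altFourArmProbAt_nonneg _ _ _)
      (mul_nonneg (altFourArmProbAt_nonneg _ _ _) measureReal_nonneg)
  calc μ.real {ω | IsPivotal (arcFourArm a b r₀ N) v ω}
      ≤ μ.real (innerArcFourArm a b r₀ R₁) * μ.real (outerArcFourArm a b R₂ N) * _ := h1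
    _ ≤ (P / cH) * (2 * Kl * (4 / (cQ * cL) * (4096 * ((N : ℝ) / k) ^ (2 - β)) * altFourArmProbAt t r₀ N)) :=
        mul_le_mul hio hloc hloc0 (by positivity)
    _ = 32768 * Kl / (cH * cQ * cL) * ((N : ℝ) / k) ^ (2 - β) * (altFourArmProbAt t r₀ N * P) := by
        field_simp
        ring

/-- **The middle range** (`16k + 1024 > N`, depth `N - k ≥ N/256`): inner and local annuli only
(`measureReal_isPivotal_arcFourArm_le₂` with the box `N/2048 < 2^l ≤ N/1024`), host extension for the
inner piece and the kernel ratio bound: `P_t(v pivotal) ≤ (2^25 K_l/(c_E c_Q c_L)) π̂^alt_t(r₀, N) P_t(E)`. [cite: WernerPCMI2009, Lecture 6, §5] -/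
theorem arc_pivotal_mid (hcQ : 0 < cQ) (hcL : 0 < cL) (hcE : 0 < cE) (hKl : 0 ≤ Kl) (hβ : 0 < β)
    (hβ2 : β ≤ 2)
    (hQ : ∀ R S : ℕ, 16 * r₀ < 4 * R → 4 * R < S → S ≤ N →
      cQ * (altFourArmProbAt t r₀ R * altFourArmProbAt t (4 * R) S) ≤ altFourArmProbAt t r₀ S)
    (hL : ∀ m n : ℕ, rL ≤ m → m ≤ n → n ≤ N → cL * ((m : ℝ) / n) ^ (2 - β) ≤ altFourArmProbAt t m n)
    (hLoc : ∀ (c : Bool) (l : ℕ), l₁ + 2 ≤ l → 2 ^ (l + 2) ≤ N →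
      altFourArmProbAt t 1 (2 ^ (l - 1)) +
          altFourArmProbAt t 2 (2 ^ l) * (triSitePercolation t).real (armEvent ![c] 2 (2 ^ l)) +
          ∑ l' ∈ Finset.Ico 1 l, altFourArmProbAt t 1 (2 ^ (l' - 1)) *
            (altFourArmProbAt t (2 ^ (l' + 1)) (2 ^ l) *
              (triSitePercolation t).real (armEvent ![c] (2 ^ (l' + 1)) (2 ^ l))) ≤
        Kl * altFourArmProbAt t r (2 ^ l))
    (hExt : ∀ M : ℕ, N / 64 ≤ M → M ≤ N / 16 - 64 →
      cE * (triSitePercolation t).real (innerArcFourArm a b r₀ M) ≤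
        (triSitePercolation t).real (arcFourArm a b r₀ N))
    (hrr₀ : r ≤ r₀) (hr₀ : 1 ≤ r₀)
    (hN : 8192 * 2 ^ l₁ + 2048 * (4 * r₀ + 1) + 2048 * rL + 100000 ≤ N)
    {v : Site 2} {k : ℕ} (hk : triNorm v = k) (hk1 : N < 16 * k + 1024) (hk2 : k + N / 256 ≤ N) :
    (triSitePercolation t).real {ω | IsPivotal (arcFourArm a b r₀ N) v ω} ≤
      2 ^ 25 * Kl / (cE * cQ * cL) *
        (altFourArmProbAt t r₀ N * (triSitePercolation t).real (arcFourArm a b r₀ N)) := by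
  set μ := triSitePercolation t with hμ
  set P : ℝ := μ.real (arcFourArm a b r₀ N) with hP
  -- the box `2^l`, `N/2048 < 2^l ≤ N/1024`
  set l : ℕ := Nat.log 2 (N / 1024) with hl
  have hN1024 : N / 1024 ≠ 0 := by omega
  have hlow : 2 ^ l ≤ N / 1024 := Nat.pow_log_le_self 2 hN1024
  have hupp : N / 1024 < 2 ^ (l + 1) := Nat.lt_pow_succ_log_self (by norm_num) _
  have h2l1 : 2 ^ (l + 1) = 2 ^ l * 2 := by rw [pow_succ]
  have h2l2 : 2 ^ (l + 2) = 2 ^ l * 4 := by rw [pow_add]; norm_num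
  have hl₁ : l₁ + 2 ≤ l := by
    have h : 2 ^ (l₁ + 2) < 2 ^ (l + 1) := by
      have : 2 ^ (l₁ + 2) = 2 ^ l₁ * 4 := by rw [pow_add]; norm_num
      omega
    have := (Nat.pow_lt_pow_iff_right (by norm_num : 1 < 2)).1 h
    omega
  have hl1 : 1 ≤ l := by omega
  set d : ℕ := 2 ^ l with hd
  set R₁ : ℕ := k - d - 1 with hR₁
  set M : ℕ := min R₁ (N / 16 - 64) with hM
  have hN0 : (0 : ℝ) < N := by exact_mod_cast (show 0 < N by omega)
  have hd0 : (0 : ℝ) < d := by exact_mod_cast (show 0 < d by omega)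
  have hexp : (0 : ℝ) ≤ 2 - β := by linarith
  have hcast : ((2 ^ l : ℕ) : ℤ) = (2 : ℤ) ^ l := by push_cast; ring
  have h1 := measureReal_isPivotal_arcFourArm_le₂ (a := a) (b := b) (r₀ := r₀) (N := N) (R₁ := R₁) t hl1
    (v := v)
    (by rw [hk, ← hcast]; exact_mod_cast (show r₀ + 2 * d ≤ k by omega))
    (by rw [hk, ← hcast]; exact_mod_cast (show k + 2 * d ≤ N by omega))
    (show r₀ ≤ R₁ by omega)
    (by rw [hk, ← hcast]; exact_mod_cast (show R₁ + d < k by omega)) (show R₁ ≤ N by omega)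
  have hMm : M ≤ R₁ := min_le_left _ _
  have h2 : μ.real (innerArcFourArm a b r₀ R₁) ≤ μ.real (innerArcFourArm a b r₀ M) :=
    measureReal_mono (innerArcFourArm_anti a b r₀ (by omega) hMm) (measure_ne_top _ _)
  have h3 := hExt M (by omega) (min_le_right _ _)
  have h23 : μ.real (innerArcFourArm a b r₀ R₁) ≤ P / cE := by
    rw [le_div_iff₀ hcE, mul_comm]
    exact (mul_le_mul_of_nonneg_left h2 hcE.le).trans h3
  have h4 := sum_local_le (r := r) hLoc hl₁ (by omega)
  have h5 := alt_dyadic_le hcQ hcL hβ hβ2 hQ hL hrr₀ (by omega) (by omega) (d := d) (by omega) (by omega)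
    (by omega)
  have h6 : ((N : ℝ) / d) ^ (2 - β) ≤ 2 ^ 22 := by
    have hle : (N : ℝ) / d ≤ 2048 := by
      rw [div_le_iff₀ hd0]; exact_mod_cast (show N ≤ 2048 * d by omega)
    calc ((N : ℝ) / d) ^ (2 - β) ≤ (2048 : ℝ) ^ (2 - β) := Real.rpow_le_rpow (by positivity) hle hexp
      _ ≤ (2048 : ℝ) ^ (2 : ℝ) := Real.rpow_le_rpow_of_exponent_le (by norm_num) (by linarith)
      _ = 2 ^ 22 := by norm_num
  have hqN : 0 ≤ altFourArmProbAt t r₀ N := altFourArmProbAt_nonneg t r₀ N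
  have hloc : ∑ c : Bool, (altFourArmProbAt t 1 (2 ^ (l - 1)) +
      altFourArmProbAt t 2 (2 ^ l) * μ.real (armEvent ![c] 2 (2 ^ l)) +
      ∑ l' ∈ Finset.Ico 1 l, altFourArmProbAt t 1 (2 ^ (l' - 1)) *
        (altFourArmProbAt t (2 ^ (l' + 1)) (2 ^ l) * μ.real (armEvent ![c] (2 ^ (l' + 1)) (2 ^ l)))) ≤
      2 * Kl * (4 / (cQ * cL) * 2 ^ 22 * altFourArmProbAt t r₀ N) := by
    refine h4.trans (mul_le_mul_of_nonneg_left (h5.trans ?_) (by positivity))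
    apply mul_le_mul_of_nonneg_right _ hqN
    exact mul_le_mul_of_nonneg_left h6 (by positivity)
  have hloc0 : 0 ≤ ∑ c : Bool, (altFourArmProbAt t 1 (2 ^ (l - 1)) +
      altFourArmProbAt t 2 (2 ^ l) * μ.real (armEvent ![c] 2 (2 ^ l)) +
      ∑ l' ∈ Finset.Ico 1 l, altFourArmProbAt t 1 (2 ^ (l' - 1)) *
        (altFourArmProbAt t (2 ^ (l' + 1)) (2 ^ l) * μ.real (armEvent ![c] (2 ^ (l' + 1)) (2 ^ l)))) := by
    refine Finset.sum_nonneg fun c _ => ?_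
    refine add_nonneg (add_nonneg (altFourArmProbAt_nonneg _ _ _)
      (mul_nonneg (altFourArmProbAt_nonneg _ _ _) measureReal_nonneg)) (Finset.sum_nonneg fun l' _ => ?_)
    exact mul_nonneg (altFourArmProbAt_nonneg _ _ _)
      (mul_nonneg (altFourArmProbAt_nonneg _ _ _) measureReal_nonneg)
  calc μ.real {ω | IsPivotal (arcFourArm a b r₀ N) v ω}
      ≤ μ.real (innerArcFourArm a b r₀ R₁) * _ := h1
    _ ≤ (P / cE) * (2 * Kl * (4 / (cQ * cL) * 2 ^ 22 * altFourArmProbAt t r₀ N)) :=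
        mul_le_mul h23 hloc hloc0 (by positivity)
    _ = 2 ^ 25 * Kl / (cE * cQ * cL) * (altFourArmProbAt t r₀ N * P) := by
        field_simp
        ring

end Regimes


/-! ### The boundary layer -/

section BoundaryRegimes

variable {t : unitInterval} {a b r₀ r rL n₀ N l₁ : ℕ} {cQ cL cE Kl CH β : ℝ}

/-- The weight identity `x^{2-β} (1/x)^{1-β/2} = x^{2-β/2} (1/x)`. [folklore] -/
theorem weight_identity {x β : ℝ} (hx : 0 < x) :
    x ^ (2 - β) * x⁻¹ ^ (1 - β / 2) = x ^ (2 - β / 2) * x⁻¹ := by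
  rw [Real.inv_rpow hx.le, ← Real.rpow_neg hx.le, ← Real.rpow_add hx, ← Real.rpow_neg_one x,
    ← Real.rpow_add hx]
  ring_nf

/-- **Deep shells of the boundary layer** (depth `d' = N - |v|_𝕋` with `256 d' < N` and `d'`
beyond fixed thresholds): `boundary_pivotal_le_arc` with the box `2^l`, `2^{l+3} ≤ d' < 2^{l+4}`,
`D = 2^{K₂+2}`, `2^{K₂+4} ≤ N < 2^{K₂+5}`, `m₀ = |v| - D - 1`; host extension for
`P(innerArc(r₀, m₀))`, the local factor and kernel ratio bounds, and `bracket_deep_le` with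
`ε = β/2`: `P_t(v pivotal) ≤ K_d (N/d')^{2-β/2} (d'/N) π̂^alt_t(r₀, N) P_t(E)`,
`K_d = 2048 K_l K_B/(c_E c_Q c_L)`. [cite: WernerPCMI2009, Lecture 6, proof of Lemma 6.2 (boundary contributions)] [cite: Nolin2008, §4.6, Prop. 18 and §6.2, proof of Thm. 27, Case 3] -/
theorem arc_pivotal_deep (hab : (a = 0 ∧ b = 3) ∨ (a = 3 ∧ b = 0)) (hcQ : 0 < cQ) (hcL : 0 < cL)
    (hcE : 0 < cE) (hCH : 0 ≤ CH) (hKl : 0 ≤ Kl) (hβ : 0 < β) (hβ1 : β ≤ 1)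
    (hQ : ∀ R S : ℕ, 16 * r₀ < 4 * R → 4 * R < S → S ≤ N →
      cQ * (altFourArmProbAt t r₀ R * altFourArmProbAt t (4 * R) S) ≤ altFourArmProbAt t r₀ S)
    (hL : ∀ m n : ℕ, rL ≤ m → m ≤ n → n ≤ N → cL * ((m : ℝ) / n) ^ (2 - β) ≤ altFourArmProbAt t m n)
    (hLoc : ∀ (c : Bool) (l : ℕ), l₁ + 2 ≤ l → 2 ^ (l + 2) ≤ N →
      altFourArmProbAt t 1 (2 ^ (l - 1)) +
          altFourArmProbAt t 2 (2 ^ l) * (triSitePercolation t).real (armEvent ![c] 2 (2 ^ l)) +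
          ∑ l' ∈ Finset.Ico 1 l, altFourArmProbAt t 1 (2 ^ (l' - 1)) *
            (altFourArmProbAt t (2 ^ (l' + 1)) (2 ^ l) *
              (triSitePercolation t).real (armEvent ![c] (2 ^ (l' + 1)) (2 ^ l))) ≤
        Kl * altFourArmProbAt t r (2 ^ l))
    (hExt : ∀ M : ℕ, N / 64 ≤ M → M ≤ N / 16 - 64 →
      cE * (triSitePercolation t).real (innerArcFourArm a b r₀ M) ≤
        (triSitePercolation t).real (arcFourArm a b r₀ N))
    (hHP : ∀ m n : ℕ, n₀ ≤ m → m ≤ n → n ≤ N →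
      (triSitePercolation t).real (domArmEvent ![true, false] m n upperHalfPlane) ≤ CH * ((m : ℝ) / n))
    (hrr₀ : r ≤ r₀) (hr₀ : 1 ≤ r₀) (hNr : 20 * r₀ + 2048 ≤ N) (hNL : 5 * rL + 5 ≤ N)
    {v : Site 2} {k d' : ℕ} (hk : triNorm v = k) (hkN : k + d' = N)
    (hd'a : 2 ^ (l₁ + 6) ≤ d') (hd'b : 16 * (4 * r₀ + 2) ≤ d') (hd'c : 16 * (rL + 1) ≤ d')
    (hd'n : n₀ ≤ d') (hd'N : 256 * d' < N) :
    (triSitePercolation t).real {ω | IsPivotal (arcFourArm a b r₀ N) v ω} ≤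
      2048 * Kl * (152 * CH + (1 + 192 * CH) * (1 + 1152 * CH ^ 2 + 1344 * CH) / ((2 : ℝ) ^ (β / 2) - 1)) /
          (cE * cQ * cL) *
        (((N : ℝ) / d') ^ (2 - β / 2) * ((d' : ℝ) / N)) *
        (altFourArmProbAt t r₀ N * (triSitePercolation t).real (arcFourArm a b r₀ N)) := by
  set μ := triSitePercolation t with hμ
  set P : ℝ := μ.real (arcFourArm a b r₀ N) with hP
  set KB : ℝ := 152 * CH + (1 + 192 * CH) * (1 + 1152 * CH ^ 2 + 1344 * CH) / ((2 : ℝ) ^ (β / 2) - 1)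
    with hKB
  have ha : a = 0 ∨ a = 3 := by rcases hab with ⟨h, -⟩ | ⟨h, -⟩ <;> simp [h]
  have hb : b = 0 ∨ b = 3 := by rcases hab with ⟨-, h⟩ | ⟨-, h⟩ <;> simp [h]
  have hx1 : (1 : ℝ) < (2 : ℝ) ^ (β / 2) := Real.one_lt_rpow (by norm_num) (by linarith)
  have hKB0 : 0 ≤ KB := by
    rw [hKB]
    have : (0 : ℝ) < (2 : ℝ) ^ (β / 2) - 1 := by linarith
    positivity
  -- the scales
  have hd16 : d' / 16 ≠ 0 := by omega
  set l : ℕ := Nat.log 2 d' - 3 with hl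
  have hlog3 : 3 ≤ Nat.log 2 d' := Nat.le_log_of_pow_le (by norm_num) (by omega)
  have hlow : 2 ^ (l + 3) ≤ d' := by
    rw [hl, Nat.sub_add_cancel hlog3]; exact Nat.pow_log_le_self 2 (by omega)
  have hupp : d' < 2 ^ (l + 4) := by
    rw [hl, show Nat.log 2 d' - 3 + 4 = Nat.log 2 d' + 1 by omega]
    exact Nat.lt_pow_succ_log_self (by norm_num) _
  have el1 : 2 ^ (l + 1) = 2 ^ l * 2 := by rw [pow_succ]
  have el2 : 2 ^ (l + 2) = 2 ^ l * 4 := by rw [pow_add]; norm_num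
  have el3 : 2 ^ (l + 3) = 2 ^ l * 8 := by rw [pow_add]; norm_num
  have el4 : 2 ^ (l + 4) = 2 ^ l * 16 := by rw [pow_add]; norm_num
  have hl₁ : l₁ + 2 ≤ l := by
    have h : 2 ^ (l₁ + 6) < 2 ^ (l + 4) := by omega
    have := (Nat.pow_lt_pow_iff_right (by norm_num : 1 < 2)).1 h
    omega
  have hl1 : 1 ≤ l := by omega
  set K₂ : ℕ := Nat.log 2 N - 4 with hK₂
  have hlogN : 14 ≤ Nat.log 2 N := Nat.le_log_of_pow_le (by norm_num) (by omega)
  have hK₂low : 2 ^ (K₂ + 4) ≤ N := by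
    rw [hK₂, Nat.sub_add_cancel (by omega)]; exact Nat.pow_log_le_self 2 (by omega)
  have hK₂upp : N < 2 ^ (K₂ + 5) := by
    rw [hK₂, show Nat.log 2 N - 4 + 5 = Nat.log 2 N + 1 by omega]
    exact Nat.lt_pow_succ_log_self (by norm_num) _
  have hK₂4 : 4 ≤ K₂ := by omega
  have eK4 : 2 ^ (K₂ + 4) = 2 ^ (K₂ - 3) * 128 := by
    rw [show (128 : ℕ) = 2 ^ 7 by norm_num, ← pow_add]; congr 1; omega
  have eK5 : 2 ^ (K₂ + 5) = 2 ^ (K₂ - 3) * 256 := by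
    rw [show (256 : ℕ) = 2 ^ 8 by norm_num, ← pow_add]; congr 1; omega
  have eK2 : 2 ^ (K₂ + 2) = 2 ^ (K₂ - 3) * 32 := by
    rw [show (32 : ℕ) = 2 ^ 5 by norm_num, ← pow_add]; congr 1; omega
  have eK1 : 2 ^ (K₂ + 1) = 2 ^ (K₂ - 3) * 16 := by
    rw [show (16 : ℕ) = 2 ^ 4 by norm_num, ← pow_add]; congr 1; omega
  have eKm1 : 2 ^ (K₂ - 1) = 2 ^ (K₂ - 3) * 4 := by
    rw [show (4 : ℕ) = 2 ^ 2 by norm_num, ← pow_add]; congr 1; omega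
  have eK0 : 2 ^ K₂ = 2 ^ (K₂ - 3) * 8 := by
    rw [show (8 : ℕ) = 2 ^ 3 by norm_num, ← pow_add]; congr 1; omega
  have hdK : d' < 2 ^ (K₂ - 3) := by omega
  -- `l + 1 ≤ K₂` from `2^{l+3} ≤ d' < 2^{K₂-3}`
  have hlK : l + 1 ≤ K₂ := by
    have h : 2 ^ (l + 3) < 2 ^ (K₂ - 3) := by omega
    have := (Nat.pow_lt_pow_iff_right (by norm_num : 1 < 2)).1 h
    omega
  set D : ℕ := 2 ^ (K₂ + 2) with hD
  set m₀ : ℕ := k - D - 1 with hm₀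
  -- the per-site bound with the three factors
  have h1 := boundary_pivotal_le_arc (a := a) (b := b) (r₀ := r₀) (N := N) (D := D) (k := k) (d' := d')
    (l := l) (K₂ := K₂) (m₀ := m₀) t ha hb hr₀ hk hkN hl1 (by omega) (by omega) (by omega) (by omega)
    (by omega) (by omega) hlK (by omega) (by omega)
  -- the bracket
  have h2 := bracket_deep_le (t := t) (ε := β / 2) hCH (by linarith) (by linarith) hHP rfl (by omega)
    hK₂upp hlow hupp hdK hd'n hK₂4
  -- the inner piece
  have h3 := hExt (N / 16 - 64) (by omega) le_rfl
  have h4 : μ.real (innerArcFourArm a b r₀ m₀) ≤ P / cE := by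
    rw [le_div_iff₀ hcE, mul_comm]
    refine le_trans (mul_le_mul_of_nonneg_left (measureReal_mono
      (innerArcFourArm_anti a b r₀ (show r₀ ≤ N / 16 - 64 by omega) (show N / 16 - 64 ≤ m₀ by omega))
      (measure_ne_top _ _)) hcE.le) h3
  -- the local factor
  have h5 := sum_local_le (r := r) hLoc hl₁ (by omega)
  have h6 := alt_dyadic_le hcQ hcL hβ (by linarith) hQ hL hrr₀ (by omega) hNL (d := 2 ^ l) (by omega)
    (by omega) (by omega)
  have hN0 : (0 : ℝ) < N := by exact_mod_cast (show 0 < N by omega)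
  have hd0 : (0 : ℝ) < d' := by exact_mod_cast (show 0 < d' by omega)
  have h2l0 : (0 : ℝ) < ((2 ^ l : ℕ) : ℝ) := by positivity
  have hexp : (0 : ℝ) ≤ 2 - β := by linarith
  have h7 : ((N : ℝ) / ((2 ^ l : ℕ) : ℝ)) ^ (2 - β) ≤ 256 * ((N : ℝ) / d') ^ (2 - β) := by
    have hle : (N : ℝ) / ((2 ^ l : ℕ) : ℝ) ≤ 16 * ((N : ℝ) / d') := by
      rw [div_le_iff₀ h2l0, mul_div_assoc', div_mul_eq_mul_div, le_div_iff₀ hd0]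
      have hdk : (d' : ℝ) ≤ 16 * ((2 ^ l : ℕ) : ℝ) := by exact_mod_cast (show d' ≤ 16 * 2 ^ l by omega)
      nlinarith
    calc ((N : ℝ) / ((2 ^ l : ℕ) : ℝ)) ^ (2 - β) ≤ (16 * ((N : ℝ) / d')) ^ (2 - β) :=
          Real.rpow_le_rpow (by positivity) hle hexp
      _ = (16 : ℝ) ^ (2 - β) * ((N : ℝ) / d') ^ (2 - β) := Real.mul_rpow (by norm_num) (by positivity)
      _ ≤ (16 : ℝ) ^ (2 : ℝ) * ((N : ℝ) / d') ^ (2 - β) := by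
          apply mul_le_mul_of_nonneg_right _ (by positivity)
          exact Real.rpow_le_rpow_of_exponent_le (by norm_num) (by linarith)
      _ = 256 * ((N : ℝ) / d') ^ (2 - β) := by norm_num
  have hqN : 0 ≤ altFourArmProbAt t r₀ N := altFourArmProbAt_nonneg t r₀ N
  have hloc : ∑ c : Bool, (altFourArmProbAt t 1 (2 ^ (l - 1)) +
      altFourArmProbAt t 2 (2 ^ l) * μ.real (armEvent ![c] 2 (2 ^ l)) +
      ∑ l' ∈ Finset.Ico 1 l, altFourArmProbAt t 1 (2 ^ (l' - 1)) *
        (altFourArmProbAt t (2 ^ (l' + 1)) (2 ^ l) * μ.real (armEvent ![c] (2 ^ (l' + 1)) (2 ^ l)))) ≤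
      2 * Kl * (4 / (cQ * cL) * (256 * ((N : ℝ) / d') ^ (2 - β)) * altFourArmProbAt t r₀ N) := by
    refine h5.trans (mul_le_mul_of_nonneg_left (h6.trans ?_) (by positivity))
    apply mul_le_mul_of_nonneg_right _ hqN
    exact mul_le_mul_of_nonneg_left h7 (by positivity)
  have hloc0 : 0 ≤ ∑ c : Bool, (altFourArmProbAt t 1 (2 ^ (l - 1)) +
      altFourArmProbAt t 2 (2 ^ l) * μ.real (armEvent ![c] 2 (2 ^ l)) +
      ∑ l' ∈ Finset.Ico 1 l, altFourArmProbAt t 1 (2 ^ (l' - 1)) *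
        (altFourArmProbAt t (2 ^ (l' + 1)) (2 ^ l) * μ.real (armEvent ![c] (2 ^ (l' + 1)) (2 ^ l)))) := by
    refine Finset.sum_nonneg fun c _ => ?_
    refine add_nonneg (add_nonneg (altFourArmProbAt_nonneg _ _ _)
      (mul_nonneg (altFourArmProbAt_nonneg _ _ _) measureReal_nonneg)) (Finset.sum_nonneg fun l' _ => ?_)
    exact mul_nonneg (altFourArmProbAt_nonneg _ _ _)
      (mul_nonneg (altFourArmProbAt_nonneg _ _ _) measureReal_nonneg)
  have hbr0 : 0 ≤ μ.real (domArmEvent ![true, false] (2 ^ (l + 2) + d') (D - d') upperHalfPlane) +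
      ∑ k' ∈ Finset.Ico (l + 1) K₂,
        (if 2 ^ (l + 2) + 2 * d' + 1 ≤ 2 ^ (k' - 1) then
          μ.real (domArmEvent ![true, false] (2 ^ (l + 2) + d') (2 ^ (k' - 1) - d') upperHalfPlane)
          else 1) * μ.real (domArmEvent ![true, false] (2 ^ (k' + 2) + d') (D - d') upperHalfPlane) +
      μ.real (domArmEvent ![true, false] (2 ^ (l + 2) + d') (2 ^ (K₂ - 1) - d') upperHalfPlane) := by
    refine add_nonneg (add_nonneg measureReal_nonneg (Finset.sum_nonneg fun k' _ => ?_)) measureReal_nonneg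
    refine mul_nonneg ?_ measureReal_nonneg
    split_ifs
    · exact measureReal_nonneg
    · norm_num
  -- the weight
  have hw : ((N : ℝ) / d') ^ (2 - β) * ((d' : ℝ) / N) ^ (1 - β / 2) =
      ((N : ℝ) / d') ^ (2 - β / 2) * ((d' : ℝ) / N) := by
    have hx : 0 < (N : ℝ) / d' := div_pos hN0 hd0
    have : (d' : ℝ) / N = ((N : ℝ) / d')⁻¹ := by rw [inv_div]
    rw [this]
    exact weight_identity hx
  calc μ.real {ω | IsPivotal (arcFourArm a b r₀ N) v ω}
      ≤ μ.real (innerArcFourArm a b r₀ m₀) * _ * _ := h1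
    _ ≤ (P / cE) * (2 * Kl * (4 / (cQ * cL) * (256 * ((N : ℝ) / d') ^ (2 - β)) * altFourArmProbAt t r₀ N)) *
          (KB * ((d' : ℝ) / N) ^ (1 - β / 2)) := by
        refine mul_le_mul (mul_le_mul h4 hloc hloc0 (by positivity)) h2 hbr0 ?_
        exact mul_nonneg (by positivity) (mul_nonneg (by positivity) (mul_nonneg (by positivity) hqN))
    _ = 2048 * Kl * KB / (cE * cQ * cL) * (((N : ℝ) / d') ^ (2 - β) * ((d' : ℝ) / N) ^ (1 - β / 2)) *
          (altFourArmProbAt t r₀ N * P) := by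
        field_simp
        ring
    _ = _ := by rw [hw]

/-- **Shallow shells of the boundary layer** (depth `d' < K₀`): `boundary_pivotal_le_arc₂` with
the base radius `d₂`, the base scale `k₀`, `D = 2^{K₂+2}`, `2^{K₂+4} ≤ N < 2^{K₂+5}`,
`m₀ = |v| - D - 1`, host extension for `P(innerArc(r₀, m₀))` and the bracket bound
`bracket_shallow_le` (its constant `C` displayed): `P_t(v pivotal) ≤ (C/c_E) N^{ε-1} P_t(E)`. [cite: WernerPCMI2009, Lecture 6, proof of Lemma 6.2 (boundary contributions)] [cite: Nolin2008, §4.6 and §6.2] -/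
theorem arc_pivotal_shallow (hab : (a = 0 ∧ b = 3) ∨ (a = 3 ∧ b = 0)) (hcE : 0 < cE) {ε C : ℝ}
    {d₂ k₀ K₀ : ℕ}
    (hbr : ∀ (t : unitInterval) (N K₂ D d' : ℕ),
      D = 2 ^ (K₂ + 2) → 16 * 2 ^ K₂ ≤ N → N < 2 ^ (K₂ + 5) → k₀ < K₂ → d' < K₀ →
      4 * (d₂ + K₀) ≤ 2 ^ (K₂ - 1) →
      (∀ m n : ℕ, n₀ ≤ m → m ≤ n → n ≤ N →
        (triSitePercolation t).real (domArmEvent ![true, false] m n upperHalfPlane) ≤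
          CH * ((m : ℝ) / n)) →
      ∑ k' ∈ Finset.range K₂,
          (if d₂ + 2 * d' + 1 ≤ 2 ^ (k' - 1) then
            (triSitePercolation t).real
              (domArmEvent ![true, false] (d₂ + d') (2 ^ (k' - 1) - d') upperHalfPlane)
            else 1) *
          (triSitePercolation t).real
            (domArmEvent ![true, false] (2 ^ (max k' k₀ + 2) + d') (D - d') upperHalfPlane) +
        (triSitePercolation t).real
          (domArmEvent ![true, false] (d₂ + d') (2 ^ (K₂ - 1) - d') upperHalfPlane) ≤
        C * (N : ℝ) ^ (ε - 1))
    (hExt : ∀ M : ℕ, N / 64 ≤ M → M ≤ N / 16 - 64 →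
      cE * (triSitePercolation t).real (innerArcFourArm a b r₀ M) ≤
        (triSitePercolation t).real (arcFourArm a b r₀ N))
    (hHP : ∀ m n : ℕ, n₀ ≤ m → m ≤ n → n ≤ N →
      (triSitePercolation t).real (domArmEvent ![true, false] m n upperHalfPlane) ≤ CH * ((m : ℝ) / n))
    (hr₀ : 1 ≤ r₀) (hd₂ : 1 ≤ d₂) (hNr : 20 * r₀ + 2048 ≤ N) (hN : 2 ^ (k₀ + 5) ≤ N)
    (hNK : 256 * (d₂ + K₀) + 16384 ≤ N)
    {v : Site 2} {k d' : ℕ} (hk : triNorm v = k) (hkN : k + d' = N) (hd'K : d' < K₀) :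
    (triSitePercolation t).real {ω | IsPivotal (arcFourArm a b r₀ N) v ω} ≤
      C / cE * (N : ℝ) ^ (ε - 1) * (triSitePercolation t).real (arcFourArm a b r₀ N) := by
  set μ := triSitePercolation t with hμ
  set P : ℝ := μ.real (arcFourArm a b r₀ N) with hP
  have ha : a = 0 ∨ a = 3 := by rcases hab with ⟨h, -⟩ | ⟨h, -⟩ <;> simp [h]
  have hb : b = 0 ∨ b = 3 := by rcases hab with ⟨-, h⟩ | ⟨-, h⟩ <;> simp [h]
  set K₂ : ℕ := Nat.log 2 N - 4 with hK₂
  have hlogN : 14 ≤ Nat.log 2 N := Nat.le_log_of_pow_le (by norm_num) (by omega)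
  have hK₂low : 2 ^ (K₂ + 4) ≤ N := by
    rw [hK₂, Nat.sub_add_cancel (by omega)]; exact Nat.pow_log_le_self 2 (by omega)
  have hK₂upp : N < 2 ^ (K₂ + 5) := by
    rw [hK₂, show Nat.log 2 N - 4 + 5 = Nat.log 2 N + 1 by omega]
    exact Nat.lt_pow_succ_log_self (by norm_num) _
  have eK4 : 2 ^ (K₂ + 4) = 2 ^ (K₂ - 1) * 32 := by
    rw [show (32 : ℕ) = 2 ^ 5 by norm_num, ← pow_add]; congr 1; omega
  have eK5 : 2 ^ (K₂ + 5) = 2 ^ (K₂ - 1) * 64 := by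
    rw [show (64 : ℕ) = 2 ^ 6 by norm_num, ← pow_add]; congr 1; omega
  have eK2 : 2 ^ (K₂ + 2) = 2 ^ (K₂ - 1) * 8 := by
    rw [show (8 : ℕ) = 2 ^ 3 by norm_num, ← pow_add]; congr 1; omega
  have eK1 : 2 ^ (K₂ + 1) = 2 ^ (K₂ - 1) * 4 := by
    rw [show (4 : ℕ) = 2 ^ 2 by norm_num, ← pow_add]; congr 1; omega
  have eK0 : 2 ^ K₂ = 2 ^ (K₂ - 1) * 2 := by rw [← pow_succ]; congr 1; omega
  have hk₀ : k₀ < K₂ := by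
    have h : 2 ^ (k₀ + 5) < 2 ^ (K₂ + 5) := by omega
    have := (Nat.pow_lt_pow_iff_right (by norm_num : 1 < 2)).1 h
    omega
  have hroom : 4 * (d₂ + K₀) ≤ 2 ^ (K₂ - 1) := by omega
  set D : ℕ := 2 ^ (K₂ + 2) with hD
  set m₀ : ℕ := k - D - 1 with hm₀
  have h1 := boundary_pivotal_le_arc₂ (a := a) (b := b) (r₀ := r₀) (N := N) (D := D) (k := k) (d' := d')
    (K₂ := K₂) (m₀ := m₀) t ha hb hr₀ hk hkN (by omega) (by omega) (by omega) (by omega)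
    (d₂ := d₂) (k₀ := k₀) hd₂ hk₀ (by omega) (by omega)
  have h2 := hbr t N K₂ D d' rfl (by omega) hK₂upp hk₀ hd'K hroom hHP
  have h3 := hExt (N / 16 - 64) (by omega) le_rfl
  have h4 : μ.real (innerArcFourArm a b r₀ m₀) ≤ P / cE := by
    rw [le_div_iff₀ hcE, mul_comm]
    refine le_trans (mul_le_mul_of_nonneg_left (measureReal_mono
      (innerArcFourArm_anti a b r₀ (show r₀ ≤ N / 16 - 64 by omega) (show N / 16 - 64 ≤ m₀ by omega))
      (measure_ne_top _ _)) hcE.le) h3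
  have hbr0 : 0 ≤ ∑ k' ∈ Finset.range K₂,
      (if d₂ + 2 * d' + 1 ≤ 2 ^ (k' - 1) then
        μ.real (domArmEvent ![true, false] (d₂ + d') (2 ^ (k' - 1) - d') upperHalfPlane) else 1) *
        μ.real (domArmEvent ![true, false] (2 ^ (max k' k₀ + 2) + d') (D - d') upperHalfPlane) +
      μ.real (domArmEvent ![true, false] (d₂ + d') (2 ^ (K₂ - 1) - d') upperHalfPlane) := by
    refine add_nonneg (Finset.sum_nonneg fun k' _ => ?_) measureReal_nonneg
    refine mul_nonneg ?_ measureReal_nonneg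
    split_ifs
    · exact measureReal_nonneg
    · norm_num
  calc μ.real {ω | IsPivotal (arcFourArm a b r₀ N) v ω}
      ≤ μ.real (innerArcFourArm a b r₀ m₀) * _ := h1
    _ ≤ (P / cE) * (C * (N : ℝ) ^ (ε - 1)) := mul_le_mul h4 h2 hbr0 (by positivity)
    _ = C / cE * (N : ℝ) ^ (ε - 1) * P := by ring

end BoundaryRegimes

/-! ## Part 2: the sum over the shells -/


/-- **No pivotal sites off the annulus**: `P_t(v pivotal for arcFourArm a b r₀ N) = 0` if
`v ∉ Λ_N ∖ Λ_{r₀-1}` (the event is determined by the annulus). [folklore] -/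
theorem measureReal_isPivotal_arcFourArm_eq_zero (t : unitInterval) {a b r₀ N : ℕ} (hrN : r₀ ≤ N)
    {v : Site 2} (hv : v ∉ triAnnulus r₀ N) :
    (triSitePercolation t).real {ω | IsPivotal (arcFourArm a b r₀ N) v ω} = 0 := by
  have : {ω : SiteConfig (Site 2) | IsPivotal (arcFourArm a b r₀ N) v ω} = ∅ := by
    ext ω
    simp only [mem_setOf_eq, mem_empty_iff_false, iff_false]
    intro hpiv
    have hdet := determinedBy_arcFourArm (a := a) (b := b) hrN
    rw [determinedBy_iff] at hdet
    have hvF : v ∉ (↑(triAnnulus r₀ N) : Set (Site 2)) := fun h => hv (Finset.mem_coe.1 h)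
    have key : (insert v ω ∈ arcFourArm a b r₀ N ↔ ω \ {v} ∈ arcFourArm a b r₀ N) := by
      apply hdet
      ext z
      simp only [mem_inter_iff, mem_insert_iff, mem_sdiff, mem_singleton_iff]
      constructor
      · rintro ⟨h1 | h1, h2⟩
        · exact absurd h2 (h1 ▸ hvF)
        · exact ⟨⟨h1, fun h3 => hvF (h3 ▸ h2)⟩, h2⟩
      · rintro ⟨⟨h1, -⟩, h2⟩; exact ⟨Or.inr h1, h2⟩
    rcases hpiv with ⟨h1, h2⟩ | ⟨h1, h2⟩
    · exact h2 (key.1 h1)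
    · exact h2 (key.2 h1)
  simp only [this, measureReal_empty]

/-- **`c_L N^β ≤ N² π̂^alt_t(r₀, N)`** from the a priori lower bound at `(r₀, N)` (`1 ≤ r₀`,
`(r₀/N)^{2-β} ≥ N^{β-2}`). [folklore] -/
theorem cL_rpow_le_sq_mul_alt {t : unitInterval} {N r₀ rL : ℕ} {cL β : ℝ} (hcL : 0 < cL)
    (hβ2 : β ≤ 2)
    (hL : ∀ m n : ℕ, rL ≤ m → m ≤ n → n ≤ N → cL * ((m : ℝ) / n) ^ (2 - β) ≤ altFourArmProbAt t m n)
    (hr₀ : 1 ≤ r₀) (hrL : rL ≤ r₀) (hr₀N : r₀ ≤ N) :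
    cL * (N : ℝ) ^ β ≤ (N : ℝ) ^ 2 * altFourArmProbAt t r₀ N := by
  have hN0 : (0 : ℝ) < N := by exact_mod_cast (show 0 < N by omega)
  have hr1 : (1 : ℝ) ≤ r₀ := by exact_mod_cast hr₀
  have h := hL r₀ N hrL hr₀N le_rfl
  have h1 : (N : ℝ) ^ (β - 2) ≤ ((r₀ : ℝ) / N) ^ (2 - β) := by
    rw [Real.div_rpow (by positivity) hN0.le, le_div_iff₀ (Real.rpow_pos_of_pos hN0 _),
      ← Real.rpow_add hN0, show β - 2 + (2 - β) = 0 by ring, Real.rpow_zero]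
    exact Real.one_le_rpow hr1 (by linarith)
  calc cL * (N : ℝ) ^ β = cL * (N : ℝ) ^ (β - 2) * (N : ℝ) ^ 2 := by
        rw [mul_assoc, ← Real.rpow_two, ← Real.rpow_add hN0]; ring_nf
    _ ≤ cL * ((r₀ : ℝ) / N) ^ (2 - β) * (N : ℝ) ^ 2 := by
        apply mul_le_mul_of_nonneg_right _ (by positivity)
        exact mul_le_mul_of_nonneg_left h1 hcL.le
    _ ≤ altFourArmProbAt t r₀ N * (N : ℝ) ^ 2 := mul_le_mul_of_nonneg_right h (by positivity)
    _ = (N : ℝ) ^ 2 * altFourArmProbAt t r₀ N := by ring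

-- One long bookkeeping proof over four ranges of shells (many `omega` range checks).
set_option maxHeartbeats 1600000 in
/-- **The pivotal sum of the arc-landed host** (Werner 2009, Lecture 6, §5:
"`|d/dp π̂_p(n)| ≤ … ≤ c'' π̂_p(n) × [n² π̂_p(n)]`", here for the host `E = arcFourArm a b r₀ N`
of the adjacent arrangement, at a fixed `t ∈ [1/2, 3/4]` and `N ≥ N₀`, with the kernel, host and
half-plane inputs displayed): there are `K > 0` and `N₀` such that
`Σ_{v : r₀ ≤ |v| ≤ N} P_t(v pivotal for E) ≤ K · N² π̂^alt_t(r₀, N) · P_t(E)`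
(shells `k < K₀`: `arc_pivotal_small`; `K₀ ≤ k ≤ N - N/256`: `arc_pivotal_inner` /
`arc_pivotal_mid` summed with `sum_shell_weight_le`; depth in `[K₀, N/256)`: `arc_pivotal_deep`
with `layer_sum_deep_le` at the exponent `β/2`; depth `< K₀`: `arc_pivotal_shallow` with
`layer_sum_shallow_le` and `c_L N^β ≤ N² π̂^alt`). [cite: WernerPCMI2009, Lecture 6, §5 (proof of Lemma 6.3)] [cite: Nolin2008, §6.2, proof of Thm. 27 (arXiv 0711.4948: Thm. 26)] -/
theorem arcPivotalSum_le {a b r₀ r rL rH n₀ l₁ : ℕ} {cQ cL cH cE Kl CH β : ℝ}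
    (hab : (a = 0 ∧ b = 3) ∨ (a = 3 ∧ b = 0))
    (hcQ : 0 < cQ) (hcL : 0 < cL) (hcH : 0 < cH) (hcE : 0 < cE) (hKl : 0 ≤ Kl) (hCH : 0 ≤ CH)
    (hβ : 0 < β) (hβ1 : β ≤ 1) (hrr₀ : r ≤ r₀) (hr₀ : 1 ≤ r₀) (hrL : rL ≤ r₀) :
    ∃ K : ℝ, 0 < K ∧ ∃ N₀ : ℕ, ∀ (t : unitInterval) (N : ℕ), 1 / 2 ≤ (t : ℝ) → (t : ℝ) ≤ 3 / 4 →
      N₀ ≤ N →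
      (∀ R S : ℕ, 16 * r₀ < 4 * R → 4 * R < S → S ≤ N →
        cQ * (altFourArmProbAt t r₀ R * altFourArmProbAt t (4 * R) S) ≤ altFourArmProbAt t r₀ S) →
      (∀ m n : ℕ, rL ≤ m → m ≤ n → n ≤ N → cL * ((m : ℝ) / n) ^ (2 - β) ≤ altFourArmProbAt t m n) →
      (∀ (c : Bool) (l : ℕ), l₁ + 2 ≤ l → 2 ^ (l + 2) ≤ N →
        altFourArmProbAt t 1 (2 ^ (l - 1)) +
            altFourArmProbAt t 2 (2 ^ l) * (triSitePercolation t).real (armEvent ![c] 2 (2 ^ l)) +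
            ∑ l' ∈ Finset.Ico 1 l, altFourArmProbAt t 1 (2 ^ (l' - 1)) *
              (altFourArmProbAt t (2 ^ (l' + 1)) (2 ^ l) *
                (triSitePercolation t).real (armEvent ![c] (2 ^ (l' + 1)) (2 ^ l))) ≤
          Kl * altFourArmProbAt t r (2 ^ l)) →
      (∀ m m' : ℕ, rH ≤ m → m' ≤ 8 * m → 16 * m + 1024 ≤ N →
        cH * ((triSitePercolation t).real (innerArcFourArm a b r₀ m) *
          (triSitePercolation t).real (outerArcFourArm a b m' N)) ≤
          (triSitePercolation t).real (arcFourArm a b r₀ N)) →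
      (∀ M : ℕ, N / 64 ≤ M → M ≤ N / 16 - 64 →
        cE * (triSitePercolation t).real (innerArcFourArm a b r₀ M) ≤
          (triSitePercolation t).real (arcFourArm a b r₀ N)) →
      (∀ m n : ℕ, n₀ ≤ m → m ≤ n → n ≤ N →
        (triSitePercolation t).real (domArmEvent ![true, false] m n upperHalfPlane) ≤ CH * ((m : ℝ) / n)) →
      ∑ v ∈ triAnnulus r₀ N, (triSitePercolation t).real {ω | IsPivotal (arcFourArm a b r₀ N) v ω} ≤
        K * ((N : ℝ) ^ 2 * altFourArmProbAt t r₀ N) * (triSitePercolation t).real (arcFourArm a b r₀ N) := by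
  classical
  -- thresholds
  set d₂ : ℕ := max n₀ 1 with hd₂
  set k₀ : ℕ := n₀ with hk₀
  set K₀ : ℕ := 2 ^ (l₁ + 8) + 64 * (4 * r₀ + 2) + 64 * (rL + 1) + n₀ + 2 * rH + 200 with hK₀
  obtain ⟨C, hC0, hbr⟩ := bracket_shallow_le (n₀ := n₀) (d₂ := d₂) (k₀ := k₀) (K₀ := K₀) hCH
    (show 0 < β / 2 by linarith) (show β / 2 ≤ 1 by linarith) (le_max_right _ _) (le_max_left _ _)
    (show n₀ ≤ 2 ^ (k₀ + 2) by
      rw [hk₀]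
      calc n₀ ≤ 2 ^ n₀ := Nat.lt_two_pow_self.le
        _ ≤ 2 ^ (n₀ + 2) := Nat.pow_le_pow_right (by norm_num) (by omega))
  -- constants
  set Ks : ℝ := (16 / 3 : ℝ) ^ (2 * (K₀ + 1 - r₀)) / (cH * cL) with hKs
  set Ki : ℝ := 32768 * Kl / (cH * cQ * cL) with hKi
  set Km : ℝ := 2 ^ 25 * Kl / (cE * cQ * cL) with hKm
  set Kd : ℝ := 2048 * Kl * (152 * CH + (1 + 192 * CH) * (1 + 1152 * CH ^ 2 + 1344 * CH) /
    ((2 : ℝ) ^ (β / 2) - 1)) / (cE * cQ * cL) with hKd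
  set Ksh : ℝ := (K₀ : ℝ) * C / (cE * cL) with hKsh
  have hx1 : (1 : ℝ) < (2 : ℝ) ^ (β / 2) := Real.one_lt_rpow (by norm_num) (by linarith)
  have hx0 : (0 : ℝ) < (2 : ℝ) ^ (β / 2) - 1 := by linarith
  have hKs0 : 0 ≤ Ks := by rw [hKs]; positivity
  have hKi0 : 0 ≤ Ki := by rw [hKi]; positivity
  have hKm0 : 0 ≤ Km := by rw [hKm]; positivity
  have hKd0 : 0 ≤ Kd := by rw [hKd]; positivity
  have hKsh0 : 0 ≤ Ksh := by rw [hKsh]; positivity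
  refine ⟨18 * (K₀ : ℝ) ^ 2 * Ks + 24 * (1 + 1 / β) * (Ki + Km) + 18 * Kd * (1 + 1 / (β / 2)) + 18 * Ksh + 1,
    by positivity, 256 * (d₂ + K₀) + 2 ^ (k₀ + 5) + 8192 * 2 ^ l₁ + 2048 * (4 * r₀ + 1) + 2048 * rL +
      256 * K₀ + 100000, ?_⟩
  intro t N ht ht' hN hQ hL hLoc hHost hExt hHP
  -- sizes of the thresholds (for `omega`)
  have hp1 : 1 ≤ 2 ^ l₁ := Nat.one_le_two_pow
  have hp2 : 2 ^ (l₁ + 8) = 2 ^ l₁ * 256 := by rw [pow_add]; norm_num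
  have hp3 : 1 ≤ 2 ^ (k₀ + 5) := Nat.one_le_two_pow
  have hp4 : 2 ^ (l₁ + 8) = 2 ^ (l₁ + 6) * 4 := by
    rw [show l₁ + 8 = (l₁ + 6) + 2 from rfl, pow_add _ (l₁ + 6) 2]; norm_num
  set μ := triSitePercolation t with hμ
  set P : ℝ := μ.real (arcFourArm a b r₀ N) with hP
  set W : ℝ := altFourArmProbAt t r₀ N * P with hW
  have hW0 : 0 ≤ W := mul_nonneg (altFourArmProbAt_nonneg _ _ _) measureReal_nonneg
  have hP0 : 0 ≤ P := measureReal_nonneg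
  have hN0 : (0 : ℝ) < N := by exact_mod_cast (show 0 < N by omega)
  have hN1 : 1 ≤ N := by omega
  have hβ2 : β ≤ 2 := hβ1.trans one_le_two
  have hK₀r : r₀ ≤ K₀ := by rw [hK₀]; omega
  set f : Site 2 → ℝ := fun v => μ.real {ω | IsPivotal (arcFourArm a b r₀ N) v ω} with hf
  have hf0 : ∀ v, 0 ≤ f v := fun v => measureReal_nonneg
  set M₂ : ℕ := N - N / 256 with hM₂
  have hK₀M : K₀ ≤ M₂ := by omega
  have hM₂N : M₂ + 1 ≤ N - K₀ + 1 := by omega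
  -- pass to the shells of `Λ_N`
  have hshells : ∑ v ∈ triAnnulus r₀ N, f v ≤ ∑ k ∈ Finset.range (N + 1), ∑ v ∈ triSphere k, f v := by
    rw [← sum_triBall_eq_sum_triSphere f N]
    exact Finset.sum_le_sum_of_subset_of_nonneg (fun v hv => by
      rw [mem_triAnnulus] at hv; rw [mem_triBall_iff]; exact hv.2) fun v _ _ => hf0 v
  have hrange : Finset.range (N + 1) = Finset.range K₀ ∪ Finset.Ico K₀ (M₂ + 1) ∪
      Finset.Ico (M₂ + 1) (N - K₀ + 1) ∪ Finset.Ico (N - K₀ + 1) (N + 1) := by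
    ext k; simp only [Finset.mem_union, Finset.mem_range, Finset.mem_Ico]; omega
  -- (1) small shells
  have hsmall : ∑ k ∈ Finset.range K₀, ∑ v ∈ triSphere k, f v ≤ 18 * (K₀ : ℝ) ^ 2 * Ks * ((N : ℝ) ^ 2 * W) := by
    have hsite : ∀ k ∈ Finset.range K₀, ∀ v ∈ triSphere k, f v ≤ Ks * ((N : ℝ) ^ 2 * W) := by
      intro k hk v hv
      rw [Finset.mem_range] at hk
      rw [mem_triSphere_iff] at hv
      by_cases hr : r₀ ≤ k
      · have h := arc_pivotal_small hab hcL hcH hβ ht ht' hL hHost hr₀ hrL hK₀r (show rH ≤ K₀ by omega)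
          (show 16 * K₀ + 1024 ≤ N by omega) hv hr hk
        refine h.trans (le_of_eq ?_)
        rw [hW, hKs]; ring
      · push Not at hr
        have : f v = 0 := measureReal_isPivotal_arcFourArm_eq_zero t (show r₀ ≤ N by omega)
          (by rw [mem_triAnnulus, hv]; omega)
        rw [this]; positivity
    calc ∑ k ∈ Finset.range K₀, ∑ v ∈ triSphere k, f v
        ≤ ∑ k ∈ Finset.range K₀, ((triSphere k).card : ℝ) * (Ks * ((N : ℝ) ^ 2 * W)) := by
          refine Finset.sum_le_sum fun k hk => ?_
          calc ∑ v ∈ triSphere k, f v ≤ ∑ v ∈ triSphere k, Ks * ((N : ℝ) ^ 2 * W) :=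
                Finset.sum_le_sum (hsite k hk)
            _ = _ := by rw [Finset.sum_const, nsmul_eq_mul]
      _ ≤ ∑ k ∈ Finset.range K₀, (18 * (K₀ : ℝ)) * (Ks * ((N : ℝ) ^ 2 * W)) := by
          refine Finset.sum_le_sum fun k hk => mul_le_mul_of_nonneg_right ?_ (by positivity)
          rw [Finset.mem_range] at hk
          have := card_triSphere_le k
          exact_mod_cast (show (triSphere k).card ≤ 18 * K₀ by omega)
      _ = 18 * (K₀ : ℝ) ^ 2 * Ks * ((N : ℝ) ^ 2 * W) := by
          rw [Finset.sum_const, Finset.card_range, nsmul_eq_mul]; ring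
  -- (2) bulk and middle shells
  have hbulk : ∑ k ∈ Finset.Ico K₀ (M₂ + 1), ∑ v ∈ triSphere k, f v ≤
      24 * (1 + 1 / β) * (Ki + Km) * ((N : ℝ) ^ 2 * W) := by
    have hsite : ∀ k ∈ Finset.Ico K₀ (M₂ + 1), ∀ v ∈ triSphere k,
        f v ≤ (Ki + Km) * W * ((N : ℝ) ^ (2 - β) * (max (1 : ℝ) k) ^ (β - 2)) := by
      intro k hk v hv
      rw [Finset.mem_Ico] at hk
      rw [mem_triSphere_iff] at hv
      have hk0 : (0 : ℝ) < k := by exact_mod_cast (show 0 < k by omega)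
      have hmax : max (1 : ℝ) k = k := max_eq_right (by exact_mod_cast (show 1 ≤ k by omega))
      have hratio : ((N : ℝ) / k) ^ (2 - β) = (N : ℝ) ^ (2 - β) * (max (1 : ℝ) k) ^ (β - 2) := by
        rw [hmax]; exact div_rpow_two_sub hN0.le hk0
      have hpow1 : (1 : ℝ) ≤ ((N : ℝ) / k) ^ (2 - β) := by
        apply Real.one_le_rpow _ (by linarith)
        rw [le_div_iff₀ hk0, one_mul]; exact_mod_cast (show k ≤ N by omega)
      by_cases hin : 16 * k + 1024 ≤ N
      · have h := arc_pivotal_inner hcQ hcL hcH hKl hβ hβ2 hQ hL hLoc hHost hrr₀ hr₀ (by omega) (by omega)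
          hv (show 256 * 2 ^ l₁ ≤ k by omega) (by omega) (by omega) (by omega) (by omega) hin
        refine h.trans ?_
        rw [← hratio, hW, hKi]
        calc 32768 * Kl / (cH * cQ * cL) * ((N : ℝ) / k) ^ (2 - β) * (altFourArmProbAt t r₀ N * P)
            ≤ (32768 * Kl / (cH * cQ * cL) + Km) * ((N : ℝ) / k) ^ (2 - β) * (altFourArmProbAt t r₀ N * P) := by
              apply mul_le_mul_of_nonneg_right _ hW0
              exact mul_le_mul_of_nonneg_right (by linarith) (by positivity)
          _ = _ := by ring
      · push Not at hin
        have h := arc_pivotal_mid hcQ hcL hcE hKl hβ hβ2 hQ hL hLoc hExt hrr₀ hr₀ (by omega) hv hin (by omega)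
        refine h.trans ?_
        rw [← hratio, hW, hKm]
        calc 2 ^ 25 * Kl / (cE * cQ * cL) * (altFourArmProbAt t r₀ N * P)
            = 2 ^ 25 * Kl / (cE * cQ * cL) * 1 * (altFourArmProbAt t r₀ N * P) := by ring
          _ ≤ (Ki + 2 ^ 25 * Kl / (cE * cQ * cL)) * ((N : ℝ) / k) ^ (2 - β) * (altFourArmProbAt t r₀ N * P) := by
              apply mul_le_mul_of_nonneg_right _ hW0
              exact mul_le_mul (by linarith) hpow1 zero_le_one (by positivity)
          _ = _ := by ring
    have hM1 : 1 ≤ M₂ := by omega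
    calc ∑ k ∈ Finset.Ico K₀ (M₂ + 1), ∑ v ∈ triSphere k, f v
        ≤ ∑ k ∈ Finset.Ico K₀ (M₂ + 1), ((triSphere k).card : ℝ) *
            ((Ki + Km) * W * ((N : ℝ) ^ (2 - β) * (max (1 : ℝ) k) ^ (β - 2))) := by
          refine Finset.sum_le_sum fun k hk => ?_
          calc ∑ v ∈ triSphere k, f v
              ≤ ∑ v ∈ triSphere k, (Ki + Km) * W * ((N : ℝ) ^ (2 - β) * (max (1 : ℝ) k) ^ (β - 2)) :=
                Finset.sum_le_sum (hsite k hk)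
            _ = _ := by rw [Finset.sum_const, nsmul_eq_mul]
      _ ≤ ∑ k ∈ Finset.range (M₂ + 1), ((triSphere k).card : ℝ) *
            ((Ki + Km) * W * ((N : ℝ) ^ (2 - β) * (max (1 : ℝ) k) ^ (β - 2))) := by
          refine Finset.sum_le_sum_of_subset_of_nonneg (fun k hk => ?_) fun k _ _ => by positivity
          rw [Finset.mem_Ico] at hk; rw [Finset.mem_range]; exact hk.2
      _ ≤ ∑ k ∈ Finset.range (M₂ + 1), (12 * (k : ℝ) + 6) *
            ((Ki + Km) * W * ((N : ℝ) ^ (2 - β) * (max (1 : ℝ) k) ^ (β - 2))) := by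
          refine Finset.sum_le_sum fun k _ => mul_le_mul_of_nonneg_right ?_ (by positivity)
          exact_mod_cast card_triSphere_le k
      _ = (Ki + Km) * W * (N : ℝ) ^ (2 - β) *
            ∑ k ∈ Finset.range (M₂ + 1), (12 * (k : ℝ) + 6) * (max (1 : ℝ) k) ^ (β - 2) := by
          rw [Finset.mul_sum]; refine Finset.sum_congr rfl fun k _ => ?_; ring
      _ ≤ (Ki + Km) * W * (N : ℝ) ^ (2 - β) * (24 * (1 + 1 / β) * (M₂ : ℝ) ^ β) :=
          mul_le_mul_of_nonneg_left (sum_shell_weight_le hβ hβ1 hM1) (by positivity)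
      _ ≤ (Ki + Km) * W * (N : ℝ) ^ (2 - β) * (24 * (1 + 1 / β) * (N : ℝ) ^ β) := by
          apply mul_le_mul_of_nonneg_left _ (by positivity)
          apply mul_le_mul_of_nonneg_left _ (by positivity)
          exact Real.rpow_le_rpow (by positivity) (by exact_mod_cast (show M₂ ≤ N by omega)) hβ.le
      _ = 24 * (1 + 1 / β) * (Ki + Km) * (((N : ℝ) ^ (2 - β) * (N : ℝ) ^ β) * W) := by ring
      _ = 24 * (1 + 1 / β) * (Ki + Km) * ((N : ℝ) ^ 2 * W) := by
          rw [← Real.rpow_add hN0, sub_add_cancel, Real.rpow_two]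
  -- (3) deep shells of the layer
  have hdeep : ∑ k ∈ Finset.Ico (M₂ + 1) (N - K₀ + 1), ∑ v ∈ triSphere k, f v ≤
      18 * Kd * (1 + 1 / (β / 2)) * ((N : ℝ) ^ 2 * W) := by
    refine layer_sum_deep_le hKd0 hW0 (show 0 < β / 2 by linarith) (show β / 2 ≤ 1 by linarith) hN1
      (by omega) f fun k hk v hv => ?_
    rw [Finset.mem_Ico] at hk
    rw [mem_triSphere_iff] at hv
    have h := arc_pivotal_deep hab hcQ hcL hcE hCH hKl hβ hβ1 hQ hL hLoc hExt hHP hrr₀ hr₀ (by omega)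
      (by omega) hv (show k + (N - k) = N by omega)
      (show 2 ^ (l₁ + 6) ≤ N - k by omega)
      (show 16 * (4 * r₀ + 2) ≤ N - k by omega) (show 16 * (rL + 1) ≤ N - k by omega)
      (show n₀ ≤ N - k by omega) (show 256 * (N - k) < N by omega)
    refine h.trans (le_of_eq ?_)
    rw [hW, hKd]
  -- (4) shallow shells of the layer
  have hshallow : ∑ k ∈ Finset.Ico (N - K₀ + 1) (N + 1), ∑ v ∈ triSphere k, f v ≤
      18 * Ksh * ((N : ℝ) ^ 2 * W) := by
    have hB : 0 ≤ C / cE * (N : ℝ) ^ (β / 2 - 1) * P := by positivity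
    have h := layer_sum_shallow_le (a := N - K₀ + 1) hN1 hB f fun k hk v hv => by
      rw [Finset.mem_Ico] at hk
      rw [mem_triSphere_iff] at hv
      exact arc_pivotal_shallow (ε := β / 2) hab hcE hbr hExt hHP hr₀ (le_max_right _ _) (by omega)
        (by omega) (by omega) hv (show k + (N - k) = N by omega) (show N - k < K₀ by omega)
    refine h.trans ?_
    have hcard : ((N + 1 - (N - K₀ + 1) : ℕ) : ℝ) ≤ K₀ := by
      exact_mod_cast (show N + 1 - (N - K₀ + 1) ≤ K₀ by omega)
    -- `N · N^{β/2-1} · P ≤ N^β P ≤ N² π̂ P / c_L`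
    have hNβ : (N : ℝ) * (N : ℝ) ^ (β / 2 - 1) ≤ (N : ℝ) ^ β := by
      rw [show (N : ℝ) * (N : ℝ) ^ (β / 2 - 1) = (N : ℝ) ^ (β / 2) by
        rw [Real.rpow_sub_one (ne_of_gt hN0)]; field_simp]
      exact Real.rpow_le_rpow_of_exponent_le (by exact_mod_cast hN1) (by linarith)
    have hkey := cL_rpow_le_sq_mul_alt hcL hβ2 hL hr₀ hrL (by omega)
    calc ((N + 1 - (N - K₀ + 1) : ℕ) : ℝ) * (18 * N * (C / cE * (N : ℝ) ^ (β / 2 - 1) * P))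
        ≤ (K₀ : ℝ) * (18 * N * (C / cE * (N : ℝ) ^ (β / 2 - 1) * P)) :=
          mul_le_mul_of_nonneg_right hcard (by positivity)
      _ = 18 * ((K₀ : ℝ) * C / cE) * (((N : ℝ) * (N : ℝ) ^ (β / 2 - 1)) * P) := by ring
      _ ≤ 18 * ((K₀ : ℝ) * C / cE) * ((N : ℝ) ^ β * P) :=
          mul_le_mul_of_nonneg_left (mul_le_mul_of_nonneg_right hNβ hP0)
            (mul_nonneg (by norm_num) (div_nonneg (mul_nonneg (Nat.cast_nonneg _) hC0) hcE.le))
      _ = 18 * ((K₀ : ℝ) * C / (cE * cL)) * ((cL * (N : ℝ) ^ β) * P) := by field_simp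
      _ ≤ 18 * ((K₀ : ℝ) * C / (cE * cL)) * (((N : ℝ) ^ 2 * altFourArmProbAt t r₀ N) * P) :=
          mul_le_mul_of_nonneg_left (mul_le_mul_of_nonneg_right hkey hP0)
            (mul_nonneg (by norm_num) (div_nonneg (mul_nonneg (Nat.cast_nonneg _) hC0)
              (mul_pos hcE hcL).le))
      _ = 18 * Ksh * ((N : ℝ) ^ 2 * W) := by rw [hKsh, hW]; ring
  -- total
  have htotal : ∑ k ∈ Finset.range (N + 1), ∑ v ∈ triSphere k, f v ≤
      (18 * (K₀ : ℝ) ^ 2 * Ks + 24 * (1 + 1 / β) * (Ki + Km) + 18 * Kd * (1 + 1 / (β / 2)) + 18 * Ksh) *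
        ((N : ℝ) ^ 2 * W) := by
    rw [hrange, Finset.sum_union, Finset.sum_union, Finset.sum_union]
    · calc _ ≤ 18 * (K₀ : ℝ) ^ 2 * Ks * ((N : ℝ) ^ 2 * W) + 24 * (1 + 1 / β) * (Ki + Km) * ((N : ℝ) ^ 2 * W) +
            18 * Kd * (1 + 1 / (β / 2)) * ((N : ℝ) ^ 2 * W) + 18 * Ksh * ((N : ℝ) ^ 2 * W) :=
            add_le_add (add_le_add (add_le_add hsmall hbulk) hdeep) hshallow
        _ = _ := by ring
    · rw [Finset.disjoint_left]; intro k h1 h2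
      rw [Finset.mem_range] at h1; rw [Finset.mem_Ico] at h2; omega
    · rw [Finset.disjoint_left]; intro k h1 h2
      rw [Finset.mem_union, Finset.mem_range, Finset.mem_Ico] at h1; rw [Finset.mem_Ico] at h2; omega
    · rw [Finset.disjoint_left]; intro k h1 h2
      rw [Finset.mem_union, Finset.mem_union, Finset.mem_range, Finset.mem_Ico, Finset.mem_Ico] at h1
      rw [Finset.mem_Ico] at h2; omega
  calc ∑ v ∈ triAnnulus r₀ N, f v ≤ ∑ k ∈ Finset.range (N + 1), ∑ v ∈ triSphere k, f v := hshells
    _ ≤ _ := htotal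
    _ = (18 * (K₀ : ℝ) ^ 2 * Ks + 24 * (1 + 1 / β) * (Ki + Km) + 18 * Kd * (1 + 1 / (β / 2)) + 18 * Ksh) *
          ((N : ℝ) ^ 2 * altFourArmProbAt t r₀ N) * P := by rw [hW]; ring
    _ ≤ _ := by
        apply mul_le_mul_of_nonneg_right _ hP0
        apply mul_le_mul_of_nonneg_right _ (mul_nonneg (by positivity) (altFourArmProbAt_nonneg _ _ _))
        linarith

end Literature.Probability.Percolation
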